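import Literature.MathematicalPhysics.QuantumFieldTheory.Balaban1983to89.B9SupplySockB9P3ZdH2Per
import Literature.MathematicalPhysics.QuantumFieldTheory.Balaban1983to89.B9SupplySockB9P3ZdGammaUnivDelta2Src
import Literature.MathematicalPhysics.QuantumFieldTheory.Balaban1983to89.B8TowerBondsPrinted

/-!
# `Balaban1983to89.B9SupplySockB9P3ZdSrcPer` — THE PERIODIC SOURCED JUNCTION ([B8] Thm 8's frame (1.146) on the torus `T_P` read on `ℤᵈ`): frame-free,
# datum-keyed, periodicity-guarded SOURCE binders `SrcAtIPer` ∕ `SrcHolderAtIH2Per` ∕ `PerDRDsAt`, the sourced member supplier re-proved on them (the torus twin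
# of this seat's g18 `B9SupplySockB9P3ZdGammaUnivDelta2Src.sockSrc_core_at_univ_linPIδ2H`, without frames: `InvAtHIPer`, `GlobAtIPer`, `HolderAtIH2Per`,
# TOTAL additivity `GopAddAt`), and the family body of dag-n05-c's guarded sourced socket `SB9srcH2Per` (T6e `B8Prop3SrcZdHP2PerGamma`, landed 2026-08-28) produced from the
# binders — for the genuine torus record `opsAllZdPer` with only the five analytic binders displayed

statement-level skeleton of published theorems with citation tags; proofs where landed; nothing here is a claim about the
Yang–Mills mass gap

`[Balaban1985RegularSpaces]` ("B8", CMP **98**) Thm 8 + (1.146) p. 101 (the source term `f`), (1.58)–(1.59) p. 86, Prop. 3 p. 87, p. 92, p. 77 *«Ω_j = T_η»*.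
`[Balaban1985BackgroundPropagators]` ("B9", CMP **99**) Thm 3.3 p. 399, (3.42) p. 397, (3.43)–(3.47) p. 398, (3.20)–(3.27) pp. 394–395, Thm 3.11 p. 416, (3.69) p. 404, (3.16) p. 393.
`[Balaban1984PropagatorsII]` (2.3) p. 224.  PDF held: `paper:balaban1985-cmp99-background-propagators` pp. 394–399.

CITATION HEADER (lean-in-tree rule).  Cell `pub-ymgap` (YM Track A), DAG node N06 = [B9], seat `pub-ymgap-dag-n06-b` (g24), the (β′-PERIODIC) road.  TRIGGER: dag-n05-c
g17 I.42019 ∕ T6e I.42037 «two NEW periodic socket texts will want suppliers — `SB9srcH2Per` (sourced b9, Prop 3's frame, Thm 8 input) … = your ℤᵈ texts + periodicity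
guards; N06's to serve».  THIS FILE is the N06 supplier: it defines the periodicity-guarded, frame-free source binders (the `GlobAtIPer`-style key `U₀ ∈ 𝔄_m({Ω_j}, α₀)`,
`α₀ ≤ a_S` replaces the frame clause `(bg …).Reg335` of g5's `SrcAt`), re-proves the sourced member theorem on them in g22's frame-free periodic style
(`B9SupplySockB9P3ZdPer.sockB9P3Per_at_univ`), and wraps it into EXACTLY the hypothesis text `SB9srcH2Per` of T6e's
`B8Prop3SrcZdHP2PerGamma.sp3src_zdGF3HP₂Per_map_of_sockB9P3srcH2Per_γ` (generic in the member map `ι`, the period map `p`, the class map `ΛbP`).  Tools BY NAME: g5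
`apriori_arith_src` ∕ `msup_le_add_of_norm_le` ∕ `hquot_add_le` ∕ `hquot_sub_le` ∕ `trans_add` ∕ `msup_eq_zero_of_not_bdd` ∕ `logCfg_eq_of_univ` ∕ `mulClause_congr`, g4
`norm_Jcur_le_of_grad` ∕ `bdd_neg_three_of_pointwise`, g22's genuine-record lemmas.  Nothing is re-declared.

WHAT IS PROVED (kernel, 0 sorry; no `instance`, no `notation`; 3 `def`s + theorems).
* §1 ★ `SrcAtIPer` (def: the source term `G(U₀)·D R(U₀) D*·A` read by (3.47)@−3 — uniform bound + lines 1, 2, 4 — `≤ c_S·|f|₍₋₂₎` for every periodic unitary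
  `U₀ ∈ 𝔄_m({Ω_j}, α₀)`, `α₀ ≤ a_S`, every periodic Hermitian `A ∈ E(Ω₀)` and every periodic Hermitian source `f` in the Landau relation (1.146)), ★ `SrcHolderAtIH2Per`
  (def: the Hölder line, both points of the pair in `Ω_j`), ★ `PerDRDsAt` (def: `D R(U₀) D* A ∈ E_𝔤^per(P)` for periodic Hermitian `A` at periodic unitary `U₀`),
  `…_anti` bookkeeping.
* §2 ★★★ `sockSrc_core_at_univ_per` (THE SOURCED MEMBER SUPPLIER ON THE TORUS, frame-free: at a member `(M, i, m)` with `i.Ω 0 = univ`, from `InvAtHIPer aI` +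
  `CurvAtInAk c₆₉` + `AvgAtP q ΛbP` + `GlobAtIPer aT B₀` + `HolderAtIH2Per aT C_β β len` + `PerAtU` + `PerDRDsAt` + `GopAddAt` + `SrcAtIPer aS c_S` + `SrcHolderAtIH2Per aS c_Sβ`,
  for periodic unitary `U₀ ∈ 𝔄_m(α₀)` with `α₀ ≤ min{1∕16, aI, aT, aS, 1∕(2B₀c₆₉M+1)}`, periodic Hermitian `A′` of size `α₂ ≤ 1∕16` on the classes, periodic Hermitian
  source `f` in the relation (1.146): the FIVE (1.59) lines with source allowances `+ 2c_S|f|₍₋₂₎` (lines 1, 2, 4), none (line 3), `+ (C_β′c_S∕B₀ + c_Sβ)|f|₍₋₂₎` (line 5),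
  constants `B₀′ = max{1, 2B₀max{1,q}}`, `C_β′ = max{0, C_β}` — [B8] p. 86's chain with `J̃ = J̃₁ + S`, `S = D R D* A′`, `A′ = G(J̃₁) + G(S)` by additivity, Thm 3.3's
  block at `J̃₁`, the source binders at `S`).
* §3 ★★★ `sockB9P3srcH2Per_of_binders` (THE FAMILY BODY OF T6e's `SB9srcH2Per` ∀ `a : J` — member map `ι`, period map `p`, class map `ΛbP`, truncation `(ι a).k` —
  at `c_P = min{1∕16, aI, aT, aS, 1∕(2B₀c₆₉M+1)}`, `B₀′`, `B₀β′ = 2C_β′max{1,q}`, `γ″ = 2c_Sγ∕B₀′`, `γβ = (C_β′c_S∕B₀ + c_Sβ)γ`, from the member binders over `a`; the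
  Landau relation (1.146) for `A′` from the socket's `IsLandau146W … U₀ f W` by `logCfg_eq_of_univ` + `mulClause_congr`).
* §4 ★★★ `sockB9P3srcH2Per_opsAllZdPer_of_binders` (FOR THE GENUINE TORUS RECORD `opsAllZdPer τ L (p a) (ΛbP a) ops₀`: `CurvAtInAk`, `AvgAtP` (EDITION P₀ law
  `LevelSepPP0`), `PerAtU`, `PerDRDsAt` (`DRDs_mem_domSubHPer`), `GopAddAt` (`gopAddAt_opsAllZdPer`) DISCHARGED; displayed: `InvAtHIPer`, `GlobAtIPer`, `HolderAtIH2Per`,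
  `SrcAtIPer`, `SrcHolderAtIH2Per` — the first three are THEOREMS per member at `torusIdx` (g24 FILES 2–3), the two source binders are the next object-layer item);
  `perDRDsAt_opsAllZdPer` (the `PerDRDsAt` discharge by name).
* §5 ★★★ `sockB9P3srcH2Per_opsAllZdPer_towerBondsP` (§4 at print's class (1.31): `ΛbP a := fun k j => towerBondsP L (ι a).Ω ((ι a).Λs k) j`, so that the `|B₁|`
  line reads `towerBondsP L (ι a).Ω ((ι a).Λs (ι a).k) p.1` — T6e's hypothesis text LITERALLY).

HONEST SCOPE.  (i) Supplier ∕ packaging: NO estimate of [B9] is proved here; the binders are `Prop`s the caller supplies (per member at `torusIdx` three of five are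
theorems of this seat's g24 files; `SrcAtIPer` ∕ `SrcHolderAtIH2Per` are NOT yet inhabited for the genuine record).  (ii) `c_P` and all constants are binder-dependent,
not print's uniform ones.  (iii) Count-neutral; N05 ∕ N06 NOT discharged; K1⁹ `stmt-QuantumFields-27364` NOT closed; one finite `𝕋⁴` programme at fixed `ε`, Bałaban as
printed; R4 closes only the conditional finite-`𝕋⁴` rung `BalabanLadder.UV` — nothing continuum ∕ ℝ⁴ ∕ OS ∕ mass gap ∕ Clay.  Unit `pub-ymgap-dag-n06-b` (g24), 2026-08-28.
-/

noncomputable section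

namespace Literature.MathematicalPhysics.QuantumFieldTheory.Balaban1983to89.B9SupplySockB9P3ZdSrcPer

open B7Prop1Explicit B7Prop2Explicit
open B7Prop1Local (InBox loK bondHiK)
open B7Prop4GeneralLevels (linCovIter)
open B8Ineq132 (covDerivFwd covDeriv InAk BondTouches)
open B8Eq184Proof (cfgExp)
open B8Lemma1NonAbelian (mulCfg)
open B8Eq140Level (SideTouches)
open B8Eq146AExpansion (iEta plaqCovDeriv)
open B8Eq143PlaqExpansion (pdiv)
open B8Eq155JBound (Jcur wsup)
open B8ScaledSupNorm (bondNorm msup weight Bdd)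
open B8Eq138LandauZd (IsLandau138 IsLandau146W InR138 covLap covDivB QT logCfg)
open B8LeafModelZd (ZdIdx)
open B9Eq340HolderZd (hquot AdmPair trans)
open B9SupplySockB9P3ZdLetters (OpsZd deltaAOf)
open B9SupplySockB9P3ZdLettersOmega (OnDom)
open B9SupplySockB9P3Zd (norm_Jcur_le_of_grad bdd_neg_three_of_pointwise)
open B9SupplySockB9P3ZdSrc (msup_eq_zero_of_not_bdd msup_le_add_of_norm_le hquot_add_le hquot_sub_le trans_add apriori_arith_src)
open B9SupplySockB9P3ZdAt (GopAddAt)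
open B9SupplySockB9P3ZdGammaInAk (CurvAtInAk)
open B9SupplySockB9P3ZdGammaInAkDpZd (withDpZd)
open B9SupplySockB9P3ZdGammaUniv (AvgAtP)
open B9Eq316AveragingTransposeZd (betaTau qQ)
open B9Eq316AveragingTransposeZdPrinted (withQQP)
open B9Eq316AveragingTransposeZdLevelZero (LevelSepPP0)
open B9Eq327GreenZdHermPer (domSubHPer mem_domSubHPer_iff PerPreservingAt InvAtHIPer bondTouches_univ)
open B9SupplySockB9P3ZdPer (GlobAtIPer PerAtU perAtU_opsAllZdPer avgAtP_opsAllZdPer₀ curvAtInAk_opsAllZdPer)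
open B9SupplySockB9P3ZdH2Per (HolderAtIH2Per)
open B9SupplySockB9P3ZdAllLettersZdPer (opsAllZdPer opsAllZdPer_DRDs DRDs_mem_domSubHPer gopAddAt_opsAllZdPer)
open T4TermwiseTorus (IsPeriodic)
open B8TowerBondsPrinted (towerBondsP)

-- `Site` alone could resolve to the torus sites of `Setup.lean`; re-export the `ℤ^d` sites of `B7Prop1Explicit`.
export B7Prop1Explicit (Site)

variable {d : ℕ} {𝔸 : Type*} [CStarAlgebra 𝔸]

/-! ## §1  The periodic-guarded, frame-free source binders -/

section Binders

variable (P L : ℕ)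

/-- ★ **THE SOURCE TERM THROUGH `G(U₀)·D R(U₀) D*`, ON THE TORUS, KEYED BY THE DATUM'S CLASS** — g5's `B9SupplySockB9P3ZdAt.SrcAt` with the frame clause replaced by
`U₀ ∈ 𝔄_m({Ω_j}, α₀)`, `α₀ ≤ a_S` (as `GlobAtIPer`) and the guards «`U₀`, `A`, `f` periodic, `A`, `f` Hermitian»: for such data with `f` in the Landau relation (1.146)
(`Δ(𝟙_{Ω₀}(D*A − f)) = Q′ᵀμ` on `Ω₀`), `G(U₀)(D R D* A)` is uniformly bounded and its (3.47)@−3 entries `n = 0, 1, 3` are `≤ c_S·|f|₍₋₂₎` — what [B8] p. 92 ∕ p. 101 read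
off [4] (3.42)₃ ∕ (3.47) for the source term of (1.58). [cite: Balaban1985RegularSpaces, Thm 8 + (1.146) p.101, p.92, (1.58) p.86, p.77 («Ω_j = T_η»); Balaban1985BackgroundPropagators, (3.20)–(3.27) pp.394–395, (3.42) p.397, (3.47) p.398] -/
def SrcAtIPer (ops : ℝ → ZdIdx d L → ℕ → OpsZd d 𝔸) (aS cS : ℝ) (M : ℝ) (i : ZdIdx d L) (m : ℕ) : Prop :=
  ∀ (α₀ : ℝ) (U₀ : Site d → Fin d → 𝔸ˣ), (∀ x κ, U₀ x κ ∈ unitaryUnits 𝔸) → IsPeriodic P U₀ → 0 < α₀ → α₀ ≤ aS → InAk L m i.η α₀ i.Ω U₀ →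
    ∀ A : Site d → Fin d → 𝔸, IsPeriodic P A → OnDom L m i.η i.Ω A → (∀ (y : Site d) (τ : Fin d), IsSelfAdjoint (A y τ)) →
    ∀ f : Site d → 𝔸, IsPeriodic P f → (∀ x, IsSelfAdjoint (f x)) → Bdd L i.k i.η (-(2 : ℝ)) (fun j (x : Site d) => x ∈ i.Ω j) f →
      (∃ μ : ℕ → Site d → 𝔸, ∀ x ∈ i.Ω 0,
        covLap i.η U₀ ((i.Ω 0).indicator (covDivB i.η U₀ A - f)) x = QT L m (i.Λs m) U₀ μ x) →
      (∃ C : ℝ, ∀ (y : Site d) (τ : Fin d), ‖(ops M i m).Gop U₀ (fun z κ => (ops M i m).DRDs U₀ A z κ) y τ‖ ≤ C) ∧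
      msup L m i.η (-(1 : ℝ)) (fun j (b : Site d × Fin d) => SideTouches (i.Ω j) b.1 b.2)
          (fun b => (ops M i m).Gop U₀ (fun z κ => (ops M i m).DRDs U₀ A z κ) b.1 b.2) ≤
        cS * msup L i.k i.η (-(2 : ℝ)) (fun j (x : Site d) => x ∈ i.Ω j) f ∧
      msup L m i.η (-(2 : ℝ)) (fun j (t : Fin d × Fin d × Site d) => SideTouches (i.Ω j) t.2.2 t.2.1)
          (fun t => covDerivFwd i.η U₀ t.1 (fun z => (ops M i m).Gop U₀ (fun z κ => (ops M i m).DRDs U₀ A z κ) z t.2.1) t.2.2) ≤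
        cS * msup L i.k i.η (-(2 : ℝ)) (fun j (x : Site d) => x ∈ i.Ω j) f ∧
      bondNorm L m i.η (-(3 : ℝ)) i.Ω
          (fun x μ => covLap i.η U₀ (fun z => (ops M i m).Gop U₀ (fun z κ => (ops M i m).DRDs U₀ A z κ) z μ) x) ≤
        cS * msup L i.k i.η (-(2 : ℝ)) (fun j (x : Site d) => x ∈ i.Ω j) f

/-- ★ **THE HÖLDER LINE OF THE SOURCE TERM ON THE TORUS, BOTH POINTS OF THE PAIR IN `Ω_j`** — g18's `SrcHolderAtδ2` with the datum key and the periodic guards.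
[cite: Balaban1985RegularSpaces, Thm 8 p.101, (1.39) p.82, p.77 («Ω_j = T_η»); Balaban1985BackgroundPropagators, (3.43) p.398, (3.40) p.397] -/
def SrcHolderAtIH2Per (ops : ℝ → ZdIdx d L → ℕ → OpsZd d 𝔸) (aS cSβ : ℝ) (β : ℝ) (len : Site d → ℝ) (M : ℝ) (i : ZdIdx d L) (m : ℕ) : Prop :=
  ∀ (α₀ : ℝ) (U₀ : Site d → Fin d → 𝔸ˣ), (∀ x κ, U₀ x κ ∈ unitaryUnits 𝔸) → IsPeriodic P U₀ → 0 < α₀ → α₀ ≤ aS → InAk L m i.η α₀ i.Ω U₀ →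
    ∀ A : Site d → Fin d → 𝔸, IsPeriodic P A → OnDom L m i.η i.Ω A → (∀ (y : Site d) (τ : Fin d), IsSelfAdjoint (A y τ)) →
    ∀ f : Site d → 𝔸, IsPeriodic P f → (∀ x, IsSelfAdjoint (f x)) → Bdd L i.k i.η (-(2 : ℝ)) (fun j (x : Site d) => x ∈ i.Ω j) f →
      (∃ μ : ℕ → Site d → 𝔸, ∀ x ∈ i.Ω 0,
        covLap i.η U₀ ((i.Ω 0).indicator (covDivB i.η U₀ A - f)) x = QT L m (i.Λs m) U₀ μ x) →
      Bdd L m i.η (-(2 + β)) (fun j (q : Fin d × Fin d × (Site d × Site d)) => q.2.2 ∈ AdmPair i.η len ∧ q.2.2.1 ∈ i.Ω j ∧ q.2.2.2 ∈ i.Ω j)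
          (fun q => hquot i.η β len U₀
            (covDerivFwd i.η U₀ q.1 (fun z => (ops M i m).Gop U₀ (fun z κ => (ops M i m).DRDs U₀ A z κ) z q.2.1)) q.2.2) ∧
      msup L m i.η (-(2 + β)) (fun j (q : Fin d × Fin d × (Site d × Site d)) => q.2.2 ∈ AdmPair i.η len ∧ q.2.2.1 ∈ i.Ω j ∧ q.2.2.2 ∈ i.Ω j)
          (fun q => hquot i.η β len U₀
            (covDerivFwd i.η U₀ q.1 (fun z => (ops M i m).Gop U₀ (fun z κ => (ops M i m).DRDs U₀ A z κ) z q.2.1)) q.2.2) ≤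
        cSβ * msup L i.k i.η (-(2 : ℝ)) (fun j (x : Site d) => x ∈ i.Ω j) f

/-- ★ **THE `D R D*` LETTER PRESERVES `E_𝔤^per(P)`**: at every periodic unitary `U₀`, `D R(U₀) D* A` of a periodic Hermitian `A` is again periodic Hermitian (print:
`R(U₀)` is a projection in `L²(T_η, 𝔤)`, (3.21)).  For the genuine torus record this is `DRDs_mem_domSubHPer` (§4).
[cite: Balaban1985BackgroundPropagators, (3.20)–(3.21) p.394, (3.26) p.395; Balaban1985RegularSpaces, p.77 («Ω_j = T_η»)] -/
def PerDRDsAt (ops : ℝ → ZdIdx d L → ℕ → OpsZd d 𝔸) (M : ℝ) (i : ZdIdx d L) (m : ℕ) : Prop :=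
  ∀ (U₀ : Site d → Fin d → 𝔸ˣ), (∀ x κ, U₀ x κ ∈ unitaryUnits 𝔸) → IsPeriodic P U₀ →
    ∀ A : Site d → Fin d → 𝔸, IsPeriodic P A → (∀ (y : Site d) (τ : Fin d), IsSelfAdjoint (A y τ)) →
      (fun z κ => (ops M i m).DRDs U₀ A z κ) ∈ domSubHPer (d := d) (𝔸 := 𝔸) P

/-- `SrcAtIPer` is antitone in `a_S` and monotone in `c_S`. [cite: Balaban1985BackgroundPropagators, (3.47) p.398 (bookkeeping)] -/
theorem srcAtIPer_anti {ops : ℝ → ZdIdx d L → ℕ → OpsZd d 𝔸} {aS aS' cS cS' : ℝ} (ha : aS' ≤ aS) (hc : cS ≤ cS') {M : ℝ} {i : ZdIdx d L} {m : ℕ}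
    (h : SrcAtIPer P L ops aS cS M i m) : SrcAtIPer P L ops aS' cS' M i m := by
  intro α₀ U₀ hU₀ hper hα hαS hIn A hAp hOn hsa f hfp hfs hfB hcl
  obtain ⟨hC, h1, h2, h4⟩ := h α₀ U₀ hU₀ hper hα (hαS.trans ha) hIn A hAp hOn hsa f hfp hfs hfB hcl
  have hF : 0 ≤ msup L i.k i.η (-(2 : ℝ)) (fun j (x : Site d) => x ∈ i.Ω j) f := B8ScaledSupNorm.msup_nonneg L i.k i.hη.le _ _ _
  exact ⟨hC, h1.trans (mul_le_mul_of_nonneg_right hc hF), h2.trans (mul_le_mul_of_nonneg_right hc hF), h4.trans (mul_le_mul_of_nonneg_right hc hF)⟩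

/-- `SrcHolderAtIH2Per` is antitone in `a_S` and monotone in `c_Sβ`. [cite: Balaban1985BackgroundPropagators, (3.43) p.398 (bookkeeping)] -/
theorem srcHolderAtIH2Per_anti {ops : ℝ → ZdIdx d L → ℕ → OpsZd d 𝔸} {aS aS' cSβ cSβ' β : ℝ} {len : Site d → ℝ} (ha : aS' ≤ aS) (hc : cSβ ≤ cSβ')
    {M : ℝ} {i : ZdIdx d L} {m : ℕ} (h : SrcHolderAtIH2Per P L ops aS cSβ β len M i m) : SrcHolderAtIH2Per P L ops aS' cSβ' β len M i m := by
  intro α₀ U₀ hU₀ hper hα hαS hIn A hAp hOn hsa f hfp hfs hfB hcl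
  obtain ⟨hB, h5⟩ := h α₀ U₀ hU₀ hper hα (hαS.trans ha) hIn A hAp hOn hsa f hfp hfs hfB hcl
  exact ⟨hB, h5.trans (mul_le_mul_of_nonneg_right hc (B8ScaledSupNorm.msup_nonneg L i.k i.hη.le _ _ _))⟩

end Binders

/-! ## §2  The sourced member supplier on the torus, frame-free -/

section Supply

variable [Nontrivial 𝔸] (P L : ℕ) (ops : ℝ → ZdIdx d L → ℕ → OpsZd d 𝔸)

set_option maxHeartbeats 400000 in
/-- ★★★ **THE SOURCED JUNCTION AT ONE PERIODIC MEMBER WITH `Ω₀ = ℤᵈ`, FROM THE FRAME-FREE PERIODIC BINDERS** ([B8] p. 86's chain with the source term of Thm 8's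
frame (1.146), on the torus `T_P` read on `ℤᵈ`).  Data: `(M, i, m)` with `i.Ω 0 = univ`, `2 ≤ d`, `1 ≤ L`, `1 ≤ M`, `P ≠ 0`; binders `InvAtHIPer aI` ((3.27)),
`CurvAtInAk c₆₉` ((3.69)), `AvgAtP q ΛbP` ((3.16)), `GlobAtIPer aT B₀` ((3.47)@−3), `HolderAtIH2Per aT C_β β len` ((3.45), both points), `PerAtU`, `PerDRDsAt`, `GopAddAt`
(additivity of `G(U₀)`), `SrcAtIPer aS c_S`, `SrcHolderAtIH2Per aS c_Sβ`.  For `0 < α₀ ≤ min{1∕16, aI, aT, aS, 1∕(2B₀c₆₉M+1)}`, `0 < α₂ ≤ 1∕16`, a PERIODIC unitary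
`U₀ ∈ 𝔄_m({Ω_j}, α₀)`, a PERIODIC Hermitian `A′` with `‖A′(b)‖ ≤ α₂(Lʲη)⁻¹` on the classes and `0` off them, a PERIODIC Hermitian source `f` with `|f|₍₋₂₎ < ∞` in the
Landau relation (1.146): the five (1.59) lines with source allowances (`B₀′ = max{1, 2B₀max{1,q}}`, `C_β′ = max{0, C_β}`):
lines 1, 2, 4 `≤ B₀′(|J|₍₋₃₎ + |B₁|) + 2c_S|f|₍₋₂₎`, line 3 `≤ B₀′(|J|₍₋₃₎ + |B₁|)`, line 5 `≤ 2C_β′max{1,q}(|J|₍₋₃₎ + |B₁|) + (C_β′c_S|f|₍₋₂₎∕B₀ + c_Sβ|f|₍₋₂₎)`.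
The torus twin of g18's `sockSrc_core_at_univ_linPIδ2H`. [cite: Balaban1985RegularSpaces, Thm 8 + (1.146) p.101, (1.58)–(1.59) p.86, Prop. 3 p.87, p.92, p.77 («Ω_j = T_η»); Balaban1985BackgroundPropagators, Thm 3.3 p.399, (3.20)–(3.27) pp.394–395, (3.43), (3.47) p.398, (3.69) p.404, (3.16) p.393; Balaban1984PropagatorsII, (2.3) p.224] -/
theorem sockSrc_core_at_univ_per [NeZero P] (hL : 1 ≤ L) {c69 q aI aT aS B₀ Cβ β cS cSβ : ℝ} {len : Site d → ℝ}
    {M : ℝ} (hM1 : 1 ≤ M) (i : ZdIdx d L) (hΩ : i.Ω 0 = Set.univ) {m : ℕ}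
    (hinv : InvAtHIPer P L ops aI M i m) (hcurv : CurvAtInAk L ops c69 M i m) (ΛbP : ℕ → ℕ → Set (Site d × Fin d)) (havg : AvgAtP L ops q ΛbP M i m)
    (hglob : GlobAtIPer P L ops aT B₀ M i m) (hhol : HolderAtIH2Per P L ops aT Cβ β len M i m) (hper : PerAtU P L ops M i m) (hDRDs : PerDRDsAt P L ops M i m)
    (hadd : GopAddAt L ops M i m) (hsrc : SrcAtIPer P L ops aS cS M i m) (hsrcH : SrcHolderAtIH2Per P L ops aS cSβ β len M i m)
    (hc69 : 0 ≤ c69) (hq : 0 ≤ q) (hB₀ : 0 < B₀) (hcS : 0 ≤ cS) (hcSβ : 0 ≤ cSβ) :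
    ∀ α₀ α₂ : ℝ, 0 < α₀ →
      α₀ ≤ min (1 / 16) (min aI (min aT (min aS (1 / (2 * B₀ * c69 * M + 1))))) →
      0 < α₂ → α₂ ≤ 1 / 16 →
    ∀ (U₀ : Site d → Fin d → 𝔸ˣ), (∀ x κ, U₀ x κ ∈ unitaryUnits 𝔸) → IsPeriodic P U₀ → InAk L m i.η α₀ i.Ω U₀ →
    ∀ A' : Site d → Fin d → 𝔸, (∀ (y : Site d) (τ : Fin d), IsSelfAdjoint (A' y τ)) → IsPeriodic P A' →
    (∀ j, j ≤ m → ∀ (y : Site d) (τ : Fin d), SideTouches (i.Ω j) y τ → ‖A' y τ‖ ≤ α₂ * ((L : ℝ) ^ j * i.η)⁻¹) →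
    (∀ (y : Site d) (τ : Fin d), (∀ j, j ≤ m → ¬ SideTouches (i.Ω j) y τ) → A' y τ = 0) →
    ∀ f : Site d → 𝔸, IsPeriodic P f → (∀ x, IsSelfAdjoint (f x)) → Bdd L i.k i.η (-(2 : ℝ)) (fun j (x : Site d) => x ∈ i.Ω j) f →
    (∃ μ : ℕ → Site d → 𝔸, ∀ x ∈ i.Ω 0, covLap i.η U₀ ((i.Ω 0).indicator (covDivB i.η U₀ A' - f)) x = QT L m (i.Λs m) U₀ μ x) →
    msup L m i.η (-(1 : ℝ)) (fun j (b : Site d × Fin d) => SideTouches (i.Ω j) b.1 b.2) (fun b => A' b.1 b.2)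
        ≤ max 1 (2 * B₀ * max 1 q) * (bondNorm L m i.η (-(3 : ℝ)) i.Ω (fun x μ => Jcur i.η U₀ A' μ x)
          + wsup 1 (fun p : {p : ℕ × (Site d × Fin d) // p.1 ≤ m ∧ p.2 ∈ ΛbP m p.1} =>
              linCovIter L U₀ (iEta i.η A') p.1.1 p.1.2.1 p.1.2.2))
          + 2 * (cS * msup L i.k i.η (-(2 : ℝ)) (fun j (x : Site d) => x ∈ i.Ω j) f) ∧
      msup L m i.η (-(2 : ℝ)) (fun j (t : Fin d × Fin d × Site d) => SideTouches (i.Ω j) t.2.2 t.2.1)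
          (fun t => covDerivFwd i.η U₀ t.1 (fun z => A' z t.2.1) t.2.2)
        ≤ max 1 (2 * B₀ * max 1 q) * (bondNorm L m i.η (-(3 : ℝ)) i.Ω (fun x μ => Jcur i.η U₀ A' μ x)
          + wsup 1 (fun p : {p : ℕ × (Site d × Fin d) // p.1 ≤ m ∧ p.2 ∈ ΛbP m p.1} =>
              linCovIter L U₀ (iEta i.η A') p.1.1 p.1.2.1 p.1.2.2))
          + 2 * (cS * msup L i.k i.η (-(2 : ℝ)) (fun j (x : Site d) => x ∈ i.Ω j) f) ∧
      bondNorm L m i.η (-(3 : ℝ)) i.Ω (fun x μ => pdiv i.η U₀ (plaqCovDeriv i.η U₀ A') μ x)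
        ≤ max 1 (2 * B₀ * max 1 q) * (bondNorm L m i.η (-(3 : ℝ)) i.Ω (fun x μ => Jcur i.η U₀ A' μ x)
          + wsup 1 (fun p : {p : ℕ × (Site d × Fin d) // p.1 ≤ m ∧ p.2 ∈ ΛbP m p.1} =>
              linCovIter L U₀ (iEta i.η A') p.1.1 p.1.2.1 p.1.2.2)) ∧
      bondNorm L m i.η (-(3 : ℝ)) i.Ω (fun x μ => covLap i.η U₀ (fun z => A' z μ) x)
        ≤ max 1 (2 * B₀ * max 1 q) * (bondNorm L m i.η (-(3 : ℝ)) i.Ω (fun x μ => Jcur i.η U₀ A' μ x)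
          + wsup 1 (fun p : {p : ℕ × (Site d × Fin d) // p.1 ≤ m ∧ p.2 ∈ ΛbP m p.1} =>
              linCovIter L U₀ (iEta i.η A') p.1.1 p.1.2.1 p.1.2.2))
          + 2 * (cS * msup L i.k i.η (-(2 : ℝ)) (fun j (x : Site d) => x ∈ i.Ω j) f) ∧
      msup L m i.η (-(2 + β)) (fun j (q : Fin d × Fin d × (Site d × Site d)) => q.2.2 ∈ AdmPair i.η len ∧ q.2.2.1 ∈ i.Ω j ∧ q.2.2.2 ∈ i.Ω j)
          (fun q => hquot i.η β len U₀ (covDerivFwd i.η U₀ q.1 (fun z => A' z q.2.1)) q.2.2)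
        ≤ 2 * max 0 Cβ * max 1 q * (bondNorm L m i.η (-(3 : ℝ)) i.Ω (fun x μ => Jcur i.η U₀ A' μ x)
          + wsup 1 (fun p : {p : ℕ × (Site d × Fin d) // p.1 ≤ m ∧ p.2 ∈ ΛbP m p.1} =>
              linCovIter L U₀ (iEta i.η A') p.1.1 p.1.2.1 p.1.2.2))
          + (max 0 Cβ * (cS * msup L i.k i.η (-(2 : ℝ)) (fun j (x : Site d) => x ∈ i.Ω j) f) / B₀
            + cSβ * msup L i.k i.η (-(2 : ℝ)) (fun j (x : Site d) => x ∈ i.Ω j) f) := by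
  intro α₀ α₂ hα₀ hα₀c hα₂ hα₂16 U₀ hU₀ hU₀p hInA A' hsa hA'p h41 hA0 f hfp hfs hfB hcl
  -- the thresholds
  have hη : 0 < i.η := i.hη
  have hLr : (1 : ℝ) ≤ L := by exact_mod_cast hL
  have hM0 : 0 < M := lt_of_lt_of_le one_pos hM1
  simp only [le_min_iff] at hα₀c
  obtain ⟨-, hα₀I, hα₀T, hα₀S, hα₀θ⟩ := hα₀c
  have hκ' : 0 ≤ c69 * M * α₀ := by positivity
  have hθ : B₀ * (c69 * M * α₀) ≤ 1 / 2 := by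
    have hpos : 0 < 2 * B₀ * c69 * M + 1 := by positivity
    have h1 : α₀ * (2 * B₀ * c69 * M + 1) ≤ 1 := (le_div_iff₀ hpos).1 hα₀θ
    nlinarith [hα₀.le, hB₀.le, hκ']
  have hU₀1 : ∀ x κ, U₀ x κ ∈ U1 𝔸 := fun x κ => unitaryUnits_le_U1 (hU₀ x κ)
  -- every bond touches `Ω₀ = ℤᵈ`; A′ is a field of E(Ω₀), periodic and Hermitian, uniformly bounded
  have hBT : ∀ (y : Site d) (τ : Fin d), BondTouches (i.Ω 0) y τ := fun y τ => by rw [hΩ]; exact bondTouches_univ y τ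
  have hAbd : Bdd L m i.η (-(1 : ℝ)) (fun j (b : Site d × Fin d) => SideTouches (i.Ω j) b.1 b.2) (fun b => A' b.1 b.2) := by
    have e1 : (-(1 : ℝ)) = -((1 : ℕ) : ℝ) := by norm_num
    rw [e1]
    refine B8ScaledSupNorm.bdd_of_forall (c := α₂) fun j hj b hb => ?_
    rw [B8ScaledSupNorm.weight_neg_natCast, pow_one]
    have h := (h41 j hj b.1 b.2 hb)
    have hs : 0 < (L : ℝ) ^ j * i.η := B8ScaledSupNorm.scale_pos hL hη j
    calc (L : ℝ) ^ j * i.η * ‖A' b.1 b.2‖ ≤ (L : ℝ) ^ j * i.η * (α₂ * ((L : ℝ) ^ j * i.η)⁻¹) :=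
          mul_le_mul_of_nonneg_left h hs.le
      _ = α₂ := by rw [mul_comm α₂, ← mul_assoc, mul_inv_cancel₀ hs.ne', one_mul]
  have hOn : OnDom L m i.η i.Ω A' := ⟨fun y τ h => absurd (hBT y τ) h, hAbd⟩
  have hAglob : ∀ (y : Site d) (τ : Fin d), ‖A' y τ‖ ≤ α₂ * i.η⁻¹ := by
    intro y τ
    by_cases hmem : ∃ j, j ≤ m ∧ SideTouches (i.Ω j) y τ
    · obtain ⟨j, hj, hs⟩ := hmem
      have hLj : (1 : ℝ) ≤ (L : ℝ) ^ j := one_le_pow₀ hLr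
      calc ‖A' y τ‖ ≤ α₂ * ((L : ℝ) ^ j * i.η)⁻¹ := h41 j hj y τ hs
        _ = α₂ * i.η⁻¹ * ((L : ℝ) ^ j)⁻¹ := by rw [mul_inv]; ring
        _ ≤ α₂ * i.η⁻¹ * 1 := by
            apply mul_le_mul_of_nonneg_left (inv_le_one_of_one_le₀ hLj) (by positivity)
        _ = α₂ * i.η⁻¹ := mul_one _
    · rw [hA0 y τ fun j hj hs => hmem ⟨j, hj, hs⟩, norm_zero]
      positivity
  obtain ⟨a, ha_def⟩ : ∃ a : ℝ,
      a = msup L m i.η (-(1 : ℝ)) (fun j (b : Site d × Fin d) => SideTouches (i.Ω j) b.1 b.2) (fun b => A' b.1 b.2) := ⟨_, rfl⟩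
  have ha0 : 0 ≤ a := by rw [ha_def]; exact B8ScaledSupNorm.msup_nonneg L m hη.le _ _ _
  -- the sources: J̃₁ = J + Δ′A′ + Q*aQA′ and the (1.146) term S = DRD*A′; Δ_aA′ = J̃₁ + S; (1.58) + additivity
  obtain ⟨Jt, hJt_def⟩ : ∃ Jt : Site d → Fin d → 𝔸,
      Jt = fun x μ => Jcur i.η U₀ A' μ x + (ops M i m).Dp U₀ A' x μ + (ops M i m).QQ U₀ A' x μ := ⟨_, rfl⟩
  obtain ⟨S, hS_def⟩ : ∃ S : Site d → Fin d → 𝔸, S = fun x μ => (ops M i m).DRDs U₀ A' x μ := ⟨_, rfl⟩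
  have hJtS : Jt + S = deltaAOf i.η (ops M i m) U₀ A' := by
    funext y τ
    rw [hJt_def, hS_def]
    simp only [Pi.add_apply, deltaAOf]
    abel
  have hGJS : (ops M i m).Gop U₀ (Jt + S) = A' :=
    hinv α₀ U₀ hU₀ hU₀p hα₀I hInA A' hA'p hOn hsa (Jt + S) fun y τ _ => by rw [hJtS]
  obtain ⟨GS, hGS_def⟩ : ∃ GS : Site d → Fin d → 𝔸, GS = (ops M i m).Gop U₀ S := ⟨_, rfl⟩
  -- periodicity: Δ_aA′ and S are periodic Hermitian, hence so is J̃₁ = Δ_aA′ − S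
  have hΔper : deltaAOf i.η (ops M i m) U₀ A' ∈ domSubHPer (d := d) (𝔸 := 𝔸) P := hper U₀ hU₀ hU₀p A' ⟨hA'p, hsa⟩
  have hSper : S ∈ domSubHPer (d := d) (𝔸 := 𝔸) P := by rw [hS_def]; exact hDRDs U₀ hU₀ hU₀p A' hA'p hsa
  have hJtper : Jt ∈ domSubHPer (d := d) (𝔸 := 𝔸) P := by
    have h : Jt = deltaAOf i.η (ops M i m) U₀ A' - S := by rw [← hJtS]; abel
    rw [h]
    exact Submodule.sub_mem _ hΔper hSper
  -- the source binder at (A′, f)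
  obtain ⟨⟨C, hC⟩, hS1, hS2, hS4⟩ := hsrc α₀ U₀ hU₀ hU₀p hα₀ hα₀S hInA A' hA'p hOn hsa f hfp hfs hfB hcl
  obtain ⟨hSbdd, hS5⟩ := hsrcH α₀ U₀ hU₀ hU₀p hα₀ hα₀S hInA A' hA'p hOn hsa f hfp hfs hfB hcl
  rw [← hS_def, ← hGS_def] at hC hS1 hS2 hS4 hSbdd hS5
  obtain ⟨F, hF_def⟩ : ∃ F : ℝ, F = msup L i.k i.η (-(2 : ℝ)) (fun j (x : Site d) => x ∈ i.Ω j) f := ⟨_, rfl⟩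
  have hF0 : 0 ≤ F := by rw [hF_def]; exact B8ScaledSupNorm.msup_nonneg L i.k hη.le _ _ _
  rw [← hF_def] at hS1 hS2 hS4 hS5
  -- the right-hand side quantities: |J|₍₋₃₎ and |B₁|
  obtain ⟨nJ, hnJ_def⟩ : ∃ nJ : ℝ, nJ = bondNorm L m i.η (-(3 : ℝ)) i.Ω (fun x μ => Jcur i.η U₀ A' μ x) := ⟨_, rfl⟩
  obtain ⟨nB, hnB_def⟩ : ∃ nB : ℝ, nB = wsup 1 (fun p : {p : ℕ × (Site d × Fin d) // p.1 ≤ m ∧ p.2 ∈ ΛbP m p.1} =>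
      linCovIter L U₀ (iEta i.η A') p.1.1 p.1.2.1 p.1.2.2) := ⟨_, rfl⟩
  have hnJ0 : 0 ≤ nJ := by rw [hnJ_def]; exact B8ScaledSupNorm.msup_nonneg L m hη.le _ _ _
  have hnB0 : 0 ≤ nB := by rw [hnB_def]; exact B8Eq155JBound.wsup_nonneg zero_le_one _
  -- J is bounded (A′ is)
  have hgrad : ∀ (y : Site d) (κ τ : Fin d), ‖covDerivFwd i.η U₀ κ (fun z => A' z τ) y‖ ≤ i.η⁻¹ * (α₂ * i.η⁻¹ + α₂ * i.η⁻¹) :=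
    fun y κ τ => (B9SupplySockB9P3ZdLettersOmega.norm_covDerivFwd_le hη (hU₀1 _ _) _).trans
      (mul_le_mul_of_nonneg_left (add_le_add (hAglob _ _) (hAglob _ _)) (inv_nonneg.mpr hη.le))
  have hJbd : Bdd L m i.η (-(3 : ℝ)) (fun j (b : Site d × Fin d) => BondTouches (i.Ω j) b.1 b.2)
      (fun b => Jcur i.η U₀ A' b.2 b.1) :=
    bdd_neg_three_of_pointwise hL hη fun b => norm_Jcur_le_of_grad hη hU₀1 hgrad b.2 b.1
  -- |J̃₁|₍₋₃₎ ≤ |J|₍₋₃₎ + c₆₉ M α₀ |A′|₍₋₁₎ + q |B₁| ((3.69), (3.16))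
  have hJt : bondNorm L m i.η (-(3 : ℝ)) i.Ω Jt ≤ nJ + c69 * M * α₀ * a + q * nB := by
    have e3 : (-(3 : ℝ)) = -((3 : ℕ) : ℝ) := by norm_num
    refine B8ScaledSupNorm.msup_le (by positivity) fun j hj b hb => ?_
    have hw : weight L i.η (-(3 : ℝ)) j = ((L : ℝ) ^ j * i.η) ^ 3 := by
      rw [e3, B8ScaledSupNorm.weight_neg_natCast]
    have hw0 : 0 ≤ ((L : ℝ) ^ j * i.η) ^ 3 := by positivity
    have h1 : weight L i.η (-(3 : ℝ)) j * ‖Jcur i.η U₀ A' b.2 b.1‖ ≤ nJ := by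
      rw [hnJ_def]; exact B8ScaledSupNorm.weight_mul_norm_le_msup hJbd hj hb
    have h2 : ((L : ℝ) ^ j * i.η) ^ 3 * ‖(ops M i m).Dp U₀ A' b.1 b.2‖ ≤ c69 * M * α₀ * a := by
      rw [ha_def]; exact hcurv α₀ U₀ hU₀ hα₀ hInA A' hOn j hj b.1 b.2 hb
    have h4 : ((L : ℝ) ^ j * i.η) ^ 3 * ‖(ops M i m).QQ U₀ A' b.1 b.2‖ ≤ q * nB := by
      rw [hnB_def]; exact havg U₀ hU₀ A' hOn j hj b.1 b.2 hb
    have hsum : ‖Jt b.1 b.2‖ ≤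
        ‖Jcur i.η U₀ A' b.2 b.1‖ + ‖(ops M i m).Dp U₀ A' b.1 b.2‖ + ‖(ops M i m).QQ U₀ A' b.1 b.2‖ := by
      rw [hJt_def]
      exact norm_add₃_le
    rw [hw] at h1 ⊢
    calc ((L : ℝ) ^ j * i.η) ^ 3 * ‖Jt b.1 b.2‖
        ≤ ((L : ℝ) ^ j * i.η) ^ 3 *
            (‖Jcur i.η U₀ A' b.2 b.1‖ + ‖(ops M i m).Dp U₀ A' b.1 b.2‖ + ‖(ops M i m).QQ U₀ A' b.1 b.2‖) :=
          mul_le_mul_of_nonneg_left hsum hw0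
      _ = ((L : ℝ) ^ j * i.η) ^ 3 * ‖Jcur i.η U₀ A' b.2 b.1‖ + ((L : ℝ) ^ j * i.η) ^ 3 * ‖(ops M i m).Dp U₀ A' b.1 b.2‖ +
            ((L : ℝ) ^ j * i.η) ^ 3 * ‖(ops M i m).QQ U₀ A' b.1 b.2‖ := by ring
      _ ≤ nJ + c69 * M * α₀ * a + q * nB := add_le_add (add_le_add h1 h2) h4
  -- (1.58) + additivity: G(J̃₁) = A′ − G(S)
  have hGJ : (ops M i m).Gop U₀ Jt = A' - GS := by
    rw [hGS_def, eq_sub_iff_add_eq, ← hadd U₀ Jt S, hGJS]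
  -- Theorem 3.3's γ = −3 entries at J̃₁ (the `GlobAtIPer` binder at the periodic Hermitian J̃₁): the lines of A′ − GS
  obtain ⟨N, hN_def⟩ : ∃ N : ℝ, N = bondNorm L m i.η (-(3 : ℝ)) i.Ω Jt := ⟨_, rfl⟩
  rw [← hN_def] at hJt
  obtain ⟨hD1, hD2, hD4⟩ := hglob α₀ U₀ hU₀ hU₀p hα₀ hα₀T hInA Jt hJtper
  rw [hGJ, ← hN_def] at hD1 hD2 hD4
  have hD5 : msup L m i.η (-(2 + β))
      (fun j (q : Fin d × Fin d × (Site d × Site d)) => q.2.2 ∈ AdmPair i.η len ∧ q.2.2.1 ∈ i.Ω j ∧ q.2.2.2 ∈ i.Ω j)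
      (fun q => hquot i.η β len U₀ (covDerivFwd i.η U₀ q.1 (fun z => (A' - GS) z q.2.1)) q.2.2) ≤ max 0 Cβ * N := by
    have h := hhol α₀ U₀ hU₀ hU₀p hα₀ hα₀T hInA Jt hJtper
    rw [hGJ, ← hN_def] at h
    exact h.trans (mul_le_mul_of_nonneg_right (le_max_right _ _) (by rw [hN_def]; exact B8ScaledSupNorm.msup_nonneg L m hη.le _ _ _))
  -- splitting A′ = (A′ − GS) + GS in the four local norms (bounded families) and in the Hölder functional (junk-aware)
  have hsplit : ∀ (y : Site d) (τ : Fin d), A' y τ = (A' - GS) y τ + GS y τ := fun y τ => by simp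
  have hGSglob : ∀ (y : Site d) (τ : Fin d), ‖GS y τ‖ ≤ C := hC
  have hAGglob : ∀ (y : Site d) (τ : Fin d), ‖(A' - GS) y τ‖ ≤ α₂ * i.η⁻¹ + C := fun y τ => by
    rw [Pi.sub_apply, Pi.sub_apply]
    exact (norm_sub_le _ _).trans (add_le_add (hAglob y τ) (hC y τ))
  have e1 : (-(1 : ℝ)) = -((1 : ℕ) : ℝ) := by norm_num
  have e2 : (-(2 : ℝ)) = -((2 : ℕ) : ℝ) := by norm_num
  have e3 : (-(3 : ℝ)) = -((3 : ℕ) : ℝ) := by norm_num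
  have hL1 : a ≤ B₀ * N + cS * F := by
    rw [ha_def]
    refine (msup_le_add_of_norm_le hη.le (F := fun b : Site d × Fin d => (A' - GS) b.1 b.2) (G := fun b : Site d × Fin d => GS b.1 b.2)
      (fun b => by rw [hsplit]; exact norm_add_le _ _) ?_ ?_).trans (add_le_add hD1 hS1)
    · rw [e1]; exact B9SupplySockB9P3ZdLettersOmega.bdd_neg_of_pointwise hL hη 1 fun b => hAGglob b.1 b.2
    · rw [e1]; exact B9SupplySockB9P3ZdLettersOmega.bdd_neg_of_pointwise hL hη 1 fun b => hGSglob b.1 b.2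
  have hL2 : msup L m i.η (-(2 : ℝ)) (fun j (t : Fin d × Fin d × Site d) => SideTouches (i.Ω j) t.2.2 t.2.1)
      (fun t => covDerivFwd i.η U₀ t.1 (fun z => A' z t.2.1) t.2.2) ≤ B₀ * N + cS * F := by
    refine (msup_le_add_of_norm_le hη.le
      (F := fun t : Fin d × Fin d × Site d => covDerivFwd i.η U₀ t.1 (fun z => (A' - GS) z t.2.1) t.2.2)
      (G := fun t : Fin d × Fin d × Site d => covDerivFwd i.η U₀ t.1 (fun z => GS z t.2.1) t.2.2)
      (fun t => ?_) ?_ ?_).trans (add_le_add hD2 hS2)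
    · have h : (fun z => A' z t.2.1) = (fun z => (A' - GS) z t.2.1) + fun z => GS z t.2.1 := by
        funext z; simp
      rw [h, B8LambdaSpaceKLevel.covDerivFwd_add']
      exact norm_add_le _ _
    · rw [e2]
      refine B9SupplySockB9P3ZdLettersOmega.bdd_neg_of_pointwise hL hη 2 (c := i.η⁻¹ * ((α₂ * i.η⁻¹ + C) + (α₂ * i.η⁻¹ + C))) fun t => ?_
      exact (B9SupplySockB9P3ZdLettersOmega.norm_covDerivFwd_le hη (hU₀1 _ _) _).trans
        (mul_le_mul_of_nonneg_left (add_le_add (hAGglob _ _) (hAGglob _ _)) (inv_nonneg.mpr hη.le))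
    · rw [e2]
      refine B9SupplySockB9P3ZdLettersOmega.bdd_neg_of_pointwise hL hη 2 (c := i.η⁻¹ * (C + C)) fun t => ?_
      exact (B9SupplySockB9P3ZdLettersOmega.norm_covDerivFwd_le hη (hU₀1 _ _) _).trans
        (mul_le_mul_of_nonneg_left (add_le_add (hGSglob _ _) (hGSglob _ _)) (inv_nonneg.mpr hη.le))
  have hL4 : bondNorm L m i.η (-(3 : ℝ)) i.Ω (fun x μ => covLap i.η U₀ (fun z => A' z μ) x) ≤ B₀ * N + cS * F := by
    unfold bondNorm at hD4 hS4 ⊢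
    refine (msup_le_add_of_norm_le hη.le
      (F := fun b : Site d × Fin d => covLap i.η U₀ (fun z => (A' - GS) z b.2) b.1)
      (G := fun b : Site d × Fin d => covLap i.η U₀ (fun z => GS z b.2) b.1)
      (fun b => ?_) ?_ ?_).trans (add_le_add hD4 hS4)
    · dsimp only
      have h : (fun z => A' z b.2) = (fun z => (A' - GS) z b.2) + fun z => GS z b.2 := by
        funext z; simp
      rw [h, B9SupplySockB9P3ZdLettersOmega.covLap_add]
      exact norm_add_le _ _
    · rw [e3]
      exact B9SupplySockB9P3ZdLettersOmega.bdd_neg_of_pointwise hL hη 3 fun b =>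
        B9SupplySockB9P3ZdLettersOmega.norm_covLap_le hη hU₀1 (fun y => hAGglob y b.2) b.1
    · rw [e3]
      exact B9SupplySockB9P3ZdLettersOmega.bdd_neg_of_pointwise hL hη 3 fun b =>
        B9SupplySockB9P3ZdLettersOmega.norm_covLap_le hη hU₀1 (fun y => hGSglob y b.2) b.1
  have hCβ0 : 0 ≤ max 0 Cβ := le_max_left _ _
  have hN0 : 0 ≤ N := by rw [hN_def]; exact B8ScaledSupNorm.msup_nonneg L m hη.le _ _ _
  have hL5 : msup L m i.η (-(2 + β))
      (fun j (q : Fin d × Fin d × (Site d × Site d)) => q.2.2 ∈ AdmPair i.η len ∧ q.2.2.1 ∈ i.Ω j ∧ q.2.2.2 ∈ i.Ω j)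
      (fun q => hquot i.η β len U₀ (covDerivFwd i.η U₀ q.1 (fun z => A' z q.2.1)) q.2.2) ≤ max 0 Cβ * N + cSβ * F := by
    by_cases hB : Bdd L m i.η (-(2 + β))
        (fun j (q : Fin d × Fin d × (Site d × Site d)) => q.2.2 ∈ AdmPair i.η len ∧ q.2.2.1 ∈ i.Ω j ∧ q.2.2.2 ∈ i.Ω j)
        (fun q => hquot i.η β len U₀ (covDerivFwd i.η U₀ q.1 (fun z => A' z q.2.1)) q.2.2)
    · -- bounded: the family of A′ − GS is bounded too, and the norm splits
      have hcd : ∀ q : Fin d × Fin d × (Site d × Site d),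
          covDerivFwd i.η U₀ q.1 (fun z => (A' - GS) z q.2.1) =
            covDerivFwd i.η U₀ q.1 (fun z => A' z q.2.1) - covDerivFwd i.η U₀ q.1 (fun z => GS z q.2.1) := by
        intro q
        funext x
        have h : (fun z => A' z q.2.1) = (fun z => (A' - GS) z q.2.1) + fun z => GS z q.2.1 := by
          funext z; simp
        rw [Pi.sub_apply, h, B8LambdaSpaceKLevel.covDerivFwd_add']
        abel
      have hcd' : ∀ q : Fin d × Fin d × (Site d × Site d),
          covDerivFwd i.η U₀ q.1 (fun z => A' z q.2.1) =
            covDerivFwd i.η U₀ q.1 (fun z => (A' - GS) z q.2.1) + covDerivFwd i.η U₀ q.1 (fun z => GS z q.2.1) := by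
        intro q; rw [hcd]; abel
      have hBdiff : Bdd L m i.η (-(2 + β))
          (fun j (q : Fin d × Fin d × (Site d × Site d)) => q.2.2 ∈ AdmPair i.η len ∧ q.2.2.1 ∈ i.Ω j ∧ q.2.2.2 ∈ i.Ω j)
          (fun q => hquot i.η β len U₀ (covDerivFwd i.η U₀ q.1 (fun z => (A' - GS) z q.2.1)) q.2.2) := by
        obtain ⟨c₁, hc₁⟩ := hB
        obtain ⟨c₂, hc₂⟩ := hSbdd
        refine ⟨c₁ + c₂, fun j hj q hq => ?_⟩
        have hw0 : 0 ≤ weight L i.η (-(2 + β)) j := B8ScaledSupNorm.weight_nonneg L hη.le _ j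
        have hle : hquot i.η β len U₀ (covDerivFwd i.η U₀ q.1 (fun z => (A' - GS) z q.2.1)) q.2.2 ≤
            hquot i.η β len U₀ (covDerivFwd i.η U₀ q.1 (fun z => A' z q.2.1)) q.2.2 +
              hquot i.η β len U₀ (covDerivFwd i.η U₀ q.1 (fun z => GS z q.2.1)) q.2.2 := by
          rw [hcd]; exact hquot_sub_le hη.le β U₀ _ _ hq.1
        have hn : ∀ r : ℝ, 0 ≤ r → ‖r‖ = r := fun r hr => Real.norm_of_nonneg hr
        have hq1 := B9Eq340HolderZd.hquot_nonneg hη.le β U₀ (covDerivFwd i.η U₀ q.1 (fun z => (A' - GS) z q.2.1)) hq.1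
        have hq2 := B9Eq340HolderZd.hquot_nonneg hη.le β U₀ (covDerivFwd i.η U₀ q.1 (fun z => A' z q.2.1)) hq.1
        have hq3 := B9Eq340HolderZd.hquot_nonneg hη.le β U₀ (covDerivFwd i.η U₀ q.1 (fun z => GS z q.2.1)) hq.1
        have h₁ := hc₁ j hj q hq
        have h₂ := hc₂ j hj q hq
        rw [hn _ hq2] at h₁
        rw [hn _ hq3] at h₂
        rw [hn _ hq1]
        calc weight L i.η (-(2 + β)) j * hquot i.η β len U₀ (covDerivFwd i.η U₀ q.1 (fun z => (A' - GS) z q.2.1)) q.2.2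
            ≤ weight L i.η (-(2 + β)) j * (hquot i.η β len U₀ (covDerivFwd i.η U₀ q.1 (fun z => A' z q.2.1)) q.2.2 +
              hquot i.η β len U₀ (covDerivFwd i.η U₀ q.1 (fun z => GS z q.2.1)) q.2.2) := mul_le_mul_of_nonneg_left hle hw0
          _ ≤ c₁ + c₂ := by rw [mul_add]; exact add_le_add h₁ h₂
      refine (msup_le_add_of_norm_le hη.le
        (F := fun q : Fin d × Fin d × (Site d × Site d) => hquot i.η β len U₀ (covDerivFwd i.η U₀ q.1 (fun z => (A' - GS) z q.2.1)) q.2.2)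
        (G := fun q : Fin d × Fin d × (Site d × Site d) => hquot i.η β len U₀ (covDerivFwd i.η U₀ q.1 (fun z => GS z q.2.1)) q.2.2)
        (fun q => ?_) hBdiff hSbdd).trans (add_le_add hD5 hS5)
      -- pointwise: on non-admissible pairs both sides may be junk, but the norm splitting only needs `‖x‖ ≤ ‖y‖ + ‖z‖`
      by_cases hq : q.2.2 ∈ AdmPair i.η len
      · have hq1 := B9Eq340HolderZd.hquot_nonneg hη.le β U₀ (covDerivFwd i.η U₀ q.1 (fun z => (A' - GS) z q.2.1)) hq
        have hq2 := B9Eq340HolderZd.hquot_nonneg hη.le β U₀ (covDerivFwd i.η U₀ q.1 (fun z => A' z q.2.1)) hq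
        have hq3 := B9Eq340HolderZd.hquot_nonneg hη.le β U₀ (covDerivFwd i.η U₀ q.1 (fun z => GS z q.2.1)) hq
        rw [Real.norm_of_nonneg hq1, Real.norm_of_nonneg hq2, Real.norm_of_nonneg hq3, hcd']
        exact hquot_add_le hη.le β U₀ _ _ hq
      · -- off the admissible pairs the quotient's denominator is the same on both sides: split the numerator
        simp only [B9Eq340HolderZd.hquot_def, hcd', Real.norm_eq_abs, abs_div]
        rw [← add_div]
        by_cases hden : |(i.η * len (q.2.2.2 - q.2.2.1)) ^ β| = 0
        · simp [hden]
        · refine div_le_div_of_nonneg_right ?_ (lt_of_le_of_ne (abs_nonneg _) (Ne.symm hden)).le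
          rw [abs_of_nonneg (norm_nonneg _), abs_of_nonneg (norm_nonneg _), abs_of_nonneg (norm_nonneg _), Pi.add_apply, trans_add]
          calc ‖trans U₀ q.2.2.1 q.2.2.2 (covDerivFwd i.η U₀ q.1 (fun z => (A' - GS) z q.2.1) q.2.2.2) +
                  trans U₀ q.2.2.1 q.2.2.2 (covDerivFwd i.η U₀ q.1 (fun z => GS z q.2.1) q.2.2.2) -
                (covDerivFwd i.η U₀ q.1 (fun z => (A' - GS) z q.2.1) q.2.2.1 + covDerivFwd i.η U₀ q.1 (fun z => GS z q.2.1) q.2.2.1)‖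
              = ‖(trans U₀ q.2.2.1 q.2.2.2 (covDerivFwd i.η U₀ q.1 (fun z => (A' - GS) z q.2.1) q.2.2.2) -
                    covDerivFwd i.η U₀ q.1 (fun z => (A' - GS) z q.2.1) q.2.2.1) +
                  (trans U₀ q.2.2.1 q.2.2.2 (covDerivFwd i.η U₀ q.1 (fun z => GS z q.2.1) q.2.2.2) -
                    covDerivFwd i.η U₀ q.1 (fun z => GS z q.2.1) q.2.2.1)‖ := by congr 1; abel
            _ ≤ _ := norm_add_le _ _
    · rw [msup_eq_zero_of_not_bdd hB]
      positivity
  -- the a-priori (Neumann) step with the additive source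
  have hJJ : bondNorm L m i.η (-(3 : ℝ)) i.Ω (fun x μ => pdiv i.η U₀ (plaqCovDeriv i.η U₀ A') μ x) = nJ := by
    rw [hnJ_def]; rfl
  have hSa : 0 ≤ cS * F := mul_nonneg hcS hF0
  obtain ⟨r1, r2, r3, r4, r5⟩ := apriori_arith_src (Sh := cSβ * F) hB₀ hq hκ' hθ ha0 hnJ0 hnB0 hCβ0 hSa hJt hL1 hL2 hL4 hL5
  rw [← ha_def, ← hnJ_def, ← hnB_def, hJJ, ← hF_def]
  exact ⟨r1, r2, r3, r4, r5⟩

end Supply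

/-! ## §3  The family body of dag-n05-c's guarded sourced socket `SB9srcH2Per` from the member binders -/

section Family

variable [Nontrivial 𝔸] (L : ℕ)

set_option maxHeartbeats 400000 in
/-- ★★★ **THE BODY OF THE GUARDED SOURCED b9 SOCKET `SB9srcH2Per` (dag-n05-c T6e `B8Prop3SrcZdHP2PerGamma.sp3src_zdGF3HP₂Per_map_of_sockB9P3srcH2Per_γ`) FROM THE
PERIODIC BINDERS, ∀ `a : J`.**  Data: a member map `ι : J → ZdIdx d L` with `(ι a).Ω 0 = univ`, a period map `p` (`p a ≠ 0`), records `ops a`, a class map `ΛbP a`;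
at every `a`, at truncation `(ι a).k` and block parameter `M ≥ 1`: `InvAtHIPer aI`, `CurvAtInAk c₆₉`, `AvgAtP q (ΛbP a)`, `GlobAtIPer aT B₀`, `HolderAtIH2Per aT C_β β len`,
`PerAtU`, `PerDRDsAt`, `GopAddAt`, `SrcAtIPer aS c_S`, `SrcHolderAtIH2Per aS c_Sβ`; `2 ≤ d`, `1 ≤ L`.  Conclusion: T6e's hypothesis text TOKEN FOR TOKEN with
`cP := min{1∕16, aI, aT, aS, 1∕(2B₀c₆₉M+1)}`, `B₀ := B₀′ = max{1, 2B₀max{1,q}}`, `B₀β := 2·max{0,C_β}·max{1,q}`, `γ″ := 2c_Sγ∕B₀′`, `γβ := (max{0,C_β}·c_S∕B₀ + c_Sβ)·γ`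
and the `|B₁|` class `ΛbP a (ι a).k` (T6e: `towerBondsP L (ι a).Ω ((ι a).Λs (ι a).k)`).  Proof: the Landau relation (1.146) for `A′` from `IsLandau146W … U₀ f W`
(`logCfg_eq_of_univ` + `mulClause_congr`), then §2, then `2c_S|f|₍₋₂₎ ≤ γ″B₀′(α₀+α₁)` etc. from `|f|₍₋₂₎ < γ(α₀+α₁)`.
[cite: Balaban1985RegularSpaces, Thm 8 + (1.146) p.101, (1.58)–(1.59) p.86, Prop. 3 p.87, p.92, p.77 («Ω_j = T_η»); Balaban1985BackgroundPropagators, Thm 3.3 p.399, (3.42) p.397, (3.43)–(3.47) p.398, (3.20)–(3.27) pp.394–395] -/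
theorem sockB9P3srcH2Per_of_binders (hd2 : 2 ≤ d) (hL : 1 ≤ L) {c69 q aI aT aS B₀ Cβ β cS cSβ γ : ℝ} {len : Site d → ℝ}
    {M : ℝ} (hM1 : 1 ≤ M) {J : Type*} (ι : J → ZdIdx d L) (p : J → ℕ) (hp : ∀ a, NeZero (p a)) (hΩJ : ∀ a, (ι a).Ω 0 = Set.univ)
    (ops : J → ℝ → ZdIdx d L → ℕ → OpsZd d 𝔸) (ΛbP : J → ℕ → ℕ → Set (Site d × Fin d))
    (hinv : ∀ a, InvAtHIPer (p a) L (ops a) aI M (ι a) (ι a).k) (hcurv : ∀ a, CurvAtInAk L (ops a) c69 M (ι a) (ι a).k)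
    (havg : ∀ a, AvgAtP L (ops a) q (ΛbP a) M (ι a) (ι a).k) (hglob : ∀ a, GlobAtIPer (p a) L (ops a) aT B₀ M (ι a) (ι a).k)
    (hhol : ∀ a, HolderAtIH2Per (p a) L (ops a) aT Cβ β len M (ι a) (ι a).k) (hper : ∀ a, PerAtU (p a) L (ops a) M (ι a) (ι a).k)
    (hDRDs : ∀ a, PerDRDsAt (p a) L (ops a) M (ι a) (ι a).k) (hadd : ∀ a, GopAddAt L (ops a) M (ι a) (ι a).k)
    (hsrc : ∀ a, SrcAtIPer (p a) L (ops a) aS cS M (ι a) (ι a).k) (hsrcH : ∀ a, SrcHolderAtIH2Per (p a) L (ops a) aS cSβ β len M (ι a) (ι a).k)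
    (hc69 : 0 ≤ c69) (hq : 0 ≤ q) (hB₀ : 0 < B₀) (hcS : 0 ≤ cS) (hcSβ : 0 ≤ cSβ) :
    ∀ a : J, ∀ α₀ α₁ α₂ : ℝ, 0 < α₀ → α₀ ≤ min (1 / 16) (min aI (min aT (min aS (1 / (2 * B₀ * c69 * M + 1))))) → 0 < α₁ → 0 < α₂ →
      α₂ ≤ min (1 / 16) (min aI (min aT (min aS (1 / (2 * B₀ * c69 * M + 1))))) →
      ∀ (U₀ W : Site d → Fin d → 𝔸ˣ), (∀ x κ, U₀ x κ ∈ unitaryUnits 𝔸) → (∀ x κ, W x κ ∈ unitaryUnits 𝔸) →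
      IsPeriodic (p a) U₀ → IsPeriodic (p a) W →
      ∀ f : Site d → 𝔸, IsPeriodic (p a) f → InR138 L (ι a).k (ι a).η ((ι a).Ω 0) ((ι a).Λs (ι a).k) U₀ f →
      (∀ x, IsSelfAdjoint (f x)) → (∀ x, x ∉ (ι a).Ω 0 → f x = 0) →
      Bdd L (ι a).k (ι a).η (-(2 : ℝ)) (fun j (x : Site d) => x ∈ (ι a).Ω j) f →
      msup L (ι a).k (ι a).η (-(2 : ℝ)) (fun j (x : Site d) => x ∈ (ι a).Ω j) f < γ * (α₀ + α₁) →
      msup L (ι a).k (ι a).η (-(3 : ℝ)) (fun j (p : Fin d × Site d) => p.2 ∈ (ι a).Ω j) (fun p => covDerivFwd (ι a).η U₀ p.1 f p.2) < γ * (α₀ + α₁) →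
      InAk L (ι a).k (ι a).η α₀ (ι a).Ω U₀ → InAk L (ι a).k (ι a).η α₀ (ι a).Ω (mulCfg W U₀) → IsLandau146W L (ι a).k (ι a).η ((ι a).Ω 0) ((ι a).Λs (ι a).k) U₀ f W →
      ∀ A' : Site d → Fin d → 𝔸, (∀ y τ, IsSelfAdjoint (A' y τ)) → IsPeriodic (p a) A' →
      (∀ j, j ≤ (ι a).k → ∀ (y : Site d) (τ : Fin d), SideTouches ((ι a).Ω j) y τ →
        W y τ = cfgExp (ι a).η A' y τ ∧ ‖A' y τ‖ ≤ α₂ * ((L : ℝ) ^ j * (ι a).η)⁻¹) →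
      (∀ (y : Site d) (τ : Fin d), (∀ j, j ≤ (ι a).k → ¬ SideTouches ((ι a).Ω j) y τ) → A' y τ = 0) →
      msup L (ι a).k (ι a).η (-(1 : ℝ)) (fun j (b : Site d × Fin d) => SideTouches ((ι a).Ω j) b.1 b.2) (fun b => A' b.1 b.2)
          ≤ max 1 (2 * B₀ * max 1 q) * (bondNorm L (ι a).k (ι a).η (-(3 : ℝ)) (ι a).Ω (fun x μ => Jcur (ι a).η U₀ A' μ x)
            + wsup 1 (fun p : {p : ℕ × (Site d × Fin d) // p.1 ≤ (ι a).k ∧ p.2 ∈ ΛbP a (ι a).k p.1} =>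
                linCovIter L U₀ (iEta (ι a).η A') p.1.1 p.1.2.1 p.1.2.2)) + (2 * cS * γ / max 1 (2 * B₀ * max 1 q)) * max 1 (2 * B₀ * max 1 q) * (α₀ + α₁) ∧
        msup L (ι a).k (ι a).η (-(2 : ℝ)) (fun j (t : Fin d × Fin d × Site d) => SideTouches ((ι a).Ω j) t.2.2 t.2.1)
            (fun t => covDerivFwd (ι a).η U₀ t.1 (fun z => A' z t.2.1) t.2.2)
          ≤ max 1 (2 * B₀ * max 1 q) * (bondNorm L (ι a).k (ι a).η (-(3 : ℝ)) (ι a).Ω (fun x μ => Jcur (ι a).η U₀ A' μ x)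
            + wsup 1 (fun p : {p : ℕ × (Site d × Fin d) // p.1 ≤ (ι a).k ∧ p.2 ∈ ΛbP a (ι a).k p.1} =>
                linCovIter L U₀ (iEta (ι a).η A') p.1.1 p.1.2.1 p.1.2.2)) + (2 * cS * γ / max 1 (2 * B₀ * max 1 q)) * max 1 (2 * B₀ * max 1 q) * (α₀ + α₁) ∧
        bondNorm L (ι a).k (ι a).η (-(3 : ℝ)) (ι a).Ω (fun x μ => pdiv (ι a).η U₀ (plaqCovDeriv (ι a).η U₀ A') μ x)
          ≤ max 1 (2 * B₀ * max 1 q) * (bondNorm L (ι a).k (ι a).η (-(3 : ℝ)) (ι a).Ω (fun x μ => Jcur (ι a).η U₀ A' μ x)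
            + wsup 1 (fun p : {p : ℕ × (Site d × Fin d) // p.1 ≤ (ι a).k ∧ p.2 ∈ ΛbP a (ι a).k p.1} =>
                linCovIter L U₀ (iEta (ι a).η A') p.1.1 p.1.2.1 p.1.2.2)) + (2 * cS * γ / max 1 (2 * B₀ * max 1 q)) * max 1 (2 * B₀ * max 1 q) * (α₀ + α₁) ∧
        bondNorm L (ι a).k (ι a).η (-(3 : ℝ)) (ι a).Ω (fun x μ => covLap (ι a).η U₀ (fun z => A' z μ) x)
          ≤ max 1 (2 * B₀ * max 1 q) * (bondNorm L (ι a).k (ι a).η (-(3 : ℝ)) (ι a).Ω (fun x μ => Jcur (ι a).η U₀ A' μ x)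
            + wsup 1 (fun p : {p : ℕ × (Site d × Fin d) // p.1 ≤ (ι a).k ∧ p.2 ∈ ΛbP a (ι a).k p.1} =>
                linCovIter L U₀ (iEta (ι a).η A') p.1.1 p.1.2.1 p.1.2.2)) + (2 * cS * γ / max 1 (2 * B₀ * max 1 q)) * max 1 (2 * B₀ * max 1 q) * (α₀ + α₁) ∧
        msup L (ι a).k (ι a).η (-(2 + β)) (fun j (q : Fin d × Fin d × (Site d × Site d)) => q.2.2 ∈ AdmPair (ι a).η len ∧ q.2.2.1 ∈ (ι a).Ω j ∧ q.2.2.2 ∈ (ι a).Ω j)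
            (fun q => hquot (ι a).η β len U₀ (covDerivFwd (ι a).η U₀ q.1 (fun z => A' z q.2.1)) q.2.2)
          ≤ (2 * max 0 Cβ * max 1 q) * (bondNorm L (ι a).k (ι a).η (-(3 : ℝ)) (ι a).Ω (fun x μ => Jcur (ι a).η U₀ A' μ x)
            + wsup 1 (fun p : {p : ℕ × (Site d × Fin d) // p.1 ≤ (ι a).k ∧ p.2 ∈ ΛbP a (ι a).k p.1} =>
                linCovIter L U₀ (iEta (ι a).η A') p.1.1 p.1.2.1 p.1.2.2)) + ((max 0 Cβ * cS / B₀ + cSβ) * γ) * (α₀ + α₁) := by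
  obtain ⟨B', hB'_def⟩ : ∃ B' : ℝ, B' = max 1 (2 * B₀ * max 1 q) := ⟨_, rfl⟩
  have hB'1 : 1 ≤ B' := by rw [hB'_def]; exact le_max_left _ _
  have hB'0 : 0 < B' := lt_of_lt_of_le one_pos hB'1
  have hCβ0 : 0 ≤ max 0 Cβ := le_max_left _ _
  rw [← hB'_def]
  intro a α₀ α₁ α₂ hα₀ hα₀c hα₁ hα₂ hα₂c U₀ W hU₀ hWu hU₀p _ f hfp _ hfs _ hfB hfF _ hInA _ hLW A' hsa hA'p h41 hA0
  haveI := hp a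
  have hη : 0 < (ι a).η := (ι a).hη
  have hα₂16 : α₂ ≤ 1 / 16 := hα₂c.trans (min_le_left _ _)
  -- the multiplier clause for A′ = (iη)⁻¹ log W on every bond
  have hlog : ∀ (x : Site d) (μ : Fin d), BondTouches ((ι a).Ω 0) x μ → logCfg (ι a).η W x μ = A' x μ :=
    fun x μ _ => B9SupplySockB9P3ZdSrc.logCfg_eq_of_univ L hd2 hη (hΩJ a) U₀ hWu hα₂16 h41 x μ
  have hcl : ∃ μ : ℕ → Site d → 𝔸, ∀ x ∈ (ι a).Ω 0,
      covLap (ι a).η U₀ (((ι a).Ω 0).indicator (covDivB (ι a).η U₀ A' - f)) x = QT L (ι a).k ((ι a).Λs (ι a).k) U₀ μ x :=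
    (B9SupplySockB9P3ZdSrc.mulClause_congr f hlog).1 hLW.2
  obtain ⟨r1, r2, r3, r4, r5⟩ := sockSrc_core_at_univ_per (p a) L (ops a) hL hM1 (ι a) (hΩJ a) (hinv a) (hcurv a) (ΛbP a) (havg a) (hglob a) (hhol a)
    (hper a) (hDRDs a) (hadd a) (hsrc a) (hsrcH a) hc69 hq hB₀ hcS hcSβ α₀ α₂ hα₀ hα₀c hα₂ hα₂16 U₀ hU₀ hU₀p hInA A' hsa hA'p
    (fun j hj y τ hs => (h41 j hj y τ hs).2) hA0 f hfp hfs hfB hcl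
  rw [← hB'_def] at r1 r2 r3 r4
  -- the source allowance: 2c_S|f|₍₋₂₎ ≤ γ″B₀′(α₀ + α₁), (C_β′c_S∕B₀ + c_Sβ)|f|₍₋₂₎ ≤ γβ(α₀ + α₁)
  obtain ⟨F, hF_def⟩ : ∃ F : ℝ, F = msup L (ι a).k (ι a).η (-(2 : ℝ)) (fun j (x : Site d) => x ∈ (ι a).Ω j) f := ⟨_, rfl⟩
  rw [← hF_def] at r1 r2 r4 r5 hfF
  have hF0 : 0 ≤ F := by rw [hF_def]; exact B8ScaledSupNorm.msup_nonneg L _ hη.le _ _ _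
  have hS : 2 * (cS * F) ≤ 2 * cS * γ / B' * B' * (α₀ + α₁) := by
    have h1 : cS * F ≤ cS * (γ * (α₀ + α₁)) := mul_le_mul_of_nonneg_left hfF.le hcS
    have h2 : 2 * cS * γ / B' * B' * (α₀ + α₁) = 2 * (cS * (γ * (α₀ + α₁))) := by field_simp
    linarith
  have hSβ : max 0 Cβ * (cS * F) / B₀ + cSβ * F ≤ (max 0 Cβ * cS / B₀ + cSβ) * γ * (α₀ + α₁) := by
    have h1 : cS * F ≤ cS * (γ * (α₀ + α₁)) := mul_le_mul_of_nonneg_left hfF.le hcS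
    have h2 : max 0 Cβ * (cS * F) / B₀ ≤ max 0 Cβ * (cS * (γ * (α₀ + α₁))) / B₀ :=
      div_le_div_of_nonneg_right (mul_le_mul_of_nonneg_left h1 hCβ0) hB₀.le
    have h3 : cSβ * F ≤ cSβ * (γ * (α₀ + α₁)) := mul_le_mul_of_nonneg_left hfF.le hcSβ
    have h4 : (max 0 Cβ * cS / B₀ + cSβ) * γ * (α₀ + α₁) = max 0 Cβ * (cS * (γ * (α₀ + α₁))) / B₀ + cSβ * (γ * (α₀ + α₁)) := by
      field_simp
    linarith
  have hnn3 : 0 ≤ 2 * cS * γ / B' * B' * (α₀ + α₁) := le_trans (by positivity) hS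
  exact ⟨r1.trans (by linarith), r2.trans (by linarith), r3.trans (le_add_of_nonneg_right hnn3), r4.trans (by linarith), r5.trans (by linarith)⟩

end Family

/-! ## §4  For the genuine torus record: the structural binders discharged -/

section Genuine

variable (L : ℕ) (τ : 𝔸 →ₗ[ℂ] ℂ) [Nontrivial 𝔸] [FiniteDimensional ℝ 𝔸]

omit [Nontrivial 𝔸] in
/-- ★ **`PerDRDsAt` FOR THE GENUINE TORUS RECORD — DISCHARGED** (g22's `DRDs_mem_domSubHPer`: `D R^per(U₀) D* A ∈ E_𝔤^per(P)` for every `A` at a periodic unitary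
`U₀`; Hermitian faithful `τ`, `P ≠ 0`). [cite: Balaban1985BackgroundPropagators, (3.20)–(3.21) p.394, (3.26) p.395; Balaban1985RegularSpaces, p.77 («Ω_j = T_η»)] -/
theorem perDRDsAt_opsAllZdPer (P : ℕ) [NeZero P] (hτs : ∀ a : 𝔸, τ (star a) = starRingEnd ℂ (τ a)) (hτp : ∀ a : 𝔸, a ≠ 0 → 0 < (τ (star a * a)).re)
    (ΛbP : ℕ → ℕ → Set (Site d × Fin d)) (ops₀ : ℝ → ZdIdx d L → ℕ → OpsZd d 𝔸) (M : ℝ) (i : ZdIdx d L) (m : ℕ) :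
    PerDRDsAt P L (opsAllZdPer τ L P ΛbP ops₀) M i m :=
  fun _ hUu hU A _ _ => DRDs_mem_domSubHPer τ P hτs hτp (withDpZd (withQQP τ L ΛbP ops₀)) M i m hUu hU A

/-- ★★★ **THE GUARDED SOURCED SOCKET BODY `SB9srcH2Per` FOR THE GENUINE TORUS RECORD `opsAllZdPer τ L (p a) (ΛbP a) ops₀`, FROM THE FIVE ANALYTIC BINDERS ALONE**:
member map `ι` with `(ι a).Ω 0 = univ`, period map `p` with `L^{(ι a).k} ∣ p a`, class map `ΛbP a` with periodic sections and EDITION P₀'s law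
`LevelSepPP0 L (ι a).k (ι a).Ω (ΛbP a) s`; `2 ≤ d`, `2 ≤ L`, `1 ≤ M`, faithful Hermitian tracial `τ` with `C_τ`.  `CurvAtInAk` (c₆₉ = 14(d−1)), `AvgAtP`
(q = qQ d L C_τ β_τ s), `PerAtU`, `PerDRDsAt`, `GopAddAt` are DISCHARGED by g22's lemmas; displayed per `a`: `InvAtHIPer aI` (Thm 3.11), `GlobAtIPer aT B₀` ((3.47)@−3),
`HolderAtIH2Per aT C_β β len` ((3.45)), `SrcAtIPer aS c_S`, `SrcHolderAtIH2Per aS c_Sβ` ((3.42)₃∕(3.43) for the source term) — the N06 content of [B8] Theorem 8's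
input on the torus. [cite: Balaban1985RegularSpaces, Thm 8 + (1.146) p.101, (1.58)–(1.59) p.86, Prop. 3 p.87, (1.31) p.82, p.77 («Ω_j = T_η»); Balaban1985BackgroundPropagators, Thm 3.3 p.399, (3.42) p.397, (3.43)–(3.47) p.398, (3.27) p.395, Thm 3.11 p.416, (3.69) p.404, (3.16) p.393] -/
theorem sockB9P3srcH2Per_opsAllZdPer_of_binders (hd2 : 2 ≤ d) (hL : 2 ≤ L) (hτp : ∀ a : 𝔸, a ≠ 0 → 0 < (τ (star a * a)).re)
    (hτt : ∀ a b : 𝔸, τ (a * b) = τ (b * a)) (hτs : ∀ a : 𝔸, τ (star a) = starRingEnd ℂ (τ a))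
    {Cτ : ℝ} (hCτ : ∀ x y : 𝔸, |(τ (star x * y)).re| ≤ Cτ * ‖x‖ * ‖y‖)
    (ops₀ : ℝ → ZdIdx d L → ℕ → OpsZd d 𝔸) {M : ℝ} (hM1 : 1 ≤ M)
    {J : Type*} (ι : J → ZdIdx d L) (p : J → ℕ) (hp : ∀ a, NeZero (p a)) (hΩJ : ∀ a, (ι a).Ω 0 = Set.univ) (ΛbP : J → ℕ → ℕ → Set (Site d × Fin d)) {s : ℕ}
    (hdvd : ∀ a, L ^ (ι a).k ∣ p a) (hΛ : ∀ a, ∀ j, j ≤ (ι a).k → ∀ κ : Fin d, IsPeriodic (p a / L ^ j) (fun z => (z, κ) ∈ ΛbP a (ι a).k j))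
    (hlaw : ∀ a, LevelSepPP0 L (ι a).k (ι a).Ω (ΛbP a) s)
    {aI aT aS B₀ Cβ β cS cSβ γ : ℝ} {len : Site d → ℝ}
    (hinv : ∀ a, InvAtHIPer (p a) L (opsAllZdPer τ L (p a) (ΛbP a) ops₀) aI M (ι a) (ι a).k)
    (hglob : ∀ a, GlobAtIPer (p a) L (opsAllZdPer τ L (p a) (ΛbP a) ops₀) aT B₀ M (ι a) (ι a).k)
    (hhol : ∀ a, HolderAtIH2Per (p a) L (opsAllZdPer τ L (p a) (ΛbP a) ops₀) aT Cβ β len M (ι a) (ι a).k)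
    (hsrc : ∀ a, SrcAtIPer (p a) L (opsAllZdPer τ L (p a) (ΛbP a) ops₀) aS cS M (ι a) (ι a).k)
    (hsrcH : ∀ a, SrcHolderAtIH2Per (p a) L (opsAllZdPer τ L (p a) (ΛbP a) ops₀) aS cSβ β len M (ι a) (ι a).k)
    (hB₀ : 0 < B₀) (hcS : 0 ≤ cS) (hcSβ : 0 ≤ cSβ) :
    ∀ a : J, ∀ α₀ α₁ α₂ : ℝ, 0 < α₀ →
      α₀ ≤ min (1 / 16) (min aI (min aT (min aS (1 / (2 * B₀ * (14 * ((d - 1 : ℕ) : ℝ)) * M + 1))))) → 0 < α₁ → 0 < α₂ →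
      α₂ ≤ min (1 / 16) (min aI (min aT (min aS (1 / (2 * B₀ * (14 * ((d - 1 : ℕ) : ℝ)) * M + 1))))) →
      ∀ (U₀ W : Site d → Fin d → 𝔸ˣ), (∀ x κ, U₀ x κ ∈ unitaryUnits 𝔸) → (∀ x κ, W x κ ∈ unitaryUnits 𝔸) →
      IsPeriodic (p a) U₀ → IsPeriodic (p a) W →
      ∀ f : Site d → 𝔸, IsPeriodic (p a) f → InR138 L (ι a).k (ι a).η ((ι a).Ω 0) ((ι a).Λs (ι a).k) U₀ f →
      (∀ x, IsSelfAdjoint (f x)) → (∀ x, x ∉ (ι a).Ω 0 → f x = 0) →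
      Bdd L (ι a).k (ι a).η (-(2 : ℝ)) (fun j (x : Site d) => x ∈ (ι a).Ω j) f →
      msup L (ι a).k (ι a).η (-(2 : ℝ)) (fun j (x : Site d) => x ∈ (ι a).Ω j) f < γ * (α₀ + α₁) →
      msup L (ι a).k (ι a).η (-(3 : ℝ)) (fun j (p : Fin d × Site d) => p.2 ∈ (ι a).Ω j) (fun p => covDerivFwd (ι a).η U₀ p.1 f p.2) < γ * (α₀ + α₁) →
      InAk L (ι a).k (ι a).η α₀ (ι a).Ω U₀ → InAk L (ι a).k (ι a).η α₀ (ι a).Ω (mulCfg W U₀) → IsLandau146W L (ι a).k (ι a).η ((ι a).Ω 0) ((ι a).Λs (ι a).k) U₀ f W →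
      ∀ A' : Site d → Fin d → 𝔸, (∀ y τ, IsSelfAdjoint (A' y τ)) → IsPeriodic (p a) A' →
      (∀ j, j ≤ (ι a).k → ∀ (y : Site d) (τ : Fin d), SideTouches ((ι a).Ω j) y τ →
        W y τ = cfgExp (ι a).η A' y τ ∧ ‖A' y τ‖ ≤ α₂ * ((L : ℝ) ^ j * (ι a).η)⁻¹) →
      (∀ (y : Site d) (τ : Fin d), (∀ j, j ≤ (ι a).k → ¬ SideTouches ((ι a).Ω j) y τ) → A' y τ = 0) →
      msup L (ι a).k (ι a).η (-(1 : ℝ)) (fun j (b : Site d × Fin d) => SideTouches ((ι a).Ω j) b.1 b.2) (fun b => A' b.1 b.2)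
          ≤ max 1 (2 * B₀ * max 1 (qQ d L Cτ (betaTau τ) s)) * (bondNorm L (ι a).k (ι a).η (-(3 : ℝ)) (ι a).Ω (fun x μ => Jcur (ι a).η U₀ A' μ x)
            + wsup 1 (fun p : {p : ℕ × (Site d × Fin d) // p.1 ≤ (ι a).k ∧ p.2 ∈ ΛbP a (ι a).k p.1} =>
                linCovIter L U₀ (iEta (ι a).η A') p.1.1 p.1.2.1 p.1.2.2))
            + (2 * cS * γ / max 1 (2 * B₀ * max 1 (qQ d L Cτ (betaTau τ) s))) * max 1 (2 * B₀ * max 1 (qQ d L Cτ (betaTau τ) s)) * (α₀ + α₁) ∧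
        msup L (ι a).k (ι a).η (-(2 : ℝ)) (fun j (t : Fin d × Fin d × Site d) => SideTouches ((ι a).Ω j) t.2.2 t.2.1)
            (fun t => covDerivFwd (ι a).η U₀ t.1 (fun z => A' z t.2.1) t.2.2)
          ≤ max 1 (2 * B₀ * max 1 (qQ d L Cτ (betaTau τ) s)) * (bondNorm L (ι a).k (ι a).η (-(3 : ℝ)) (ι a).Ω (fun x μ => Jcur (ι a).η U₀ A' μ x)
            + wsup 1 (fun p : {p : ℕ × (Site d × Fin d) // p.1 ≤ (ι a).k ∧ p.2 ∈ ΛbP a (ι a).k p.1} =>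
                linCovIter L U₀ (iEta (ι a).η A') p.1.1 p.1.2.1 p.1.2.2))
            + (2 * cS * γ / max 1 (2 * B₀ * max 1 (qQ d L Cτ (betaTau τ) s))) * max 1 (2 * B₀ * max 1 (qQ d L Cτ (betaTau τ) s)) * (α₀ + α₁) ∧
        bondNorm L (ι a).k (ι a).η (-(3 : ℝ)) (ι a).Ω (fun x μ => pdiv (ι a).η U₀ (plaqCovDeriv (ι a).η U₀ A') μ x)
          ≤ max 1 (2 * B₀ * max 1 (qQ d L Cτ (betaTau τ) s)) * (bondNorm L (ι a).k (ι a).η (-(3 : ℝ)) (ι a).Ω (fun x μ => Jcur (ι a).η U₀ A' μ x)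
            + wsup 1 (fun p : {p : ℕ × (Site d × Fin d) // p.1 ≤ (ι a).k ∧ p.2 ∈ ΛbP a (ι a).k p.1} =>
                linCovIter L U₀ (iEta (ι a).η A') p.1.1 p.1.2.1 p.1.2.2))
            + (2 * cS * γ / max 1 (2 * B₀ * max 1 (qQ d L Cτ (betaTau τ) s))) * max 1 (2 * B₀ * max 1 (qQ d L Cτ (betaTau τ) s)) * (α₀ + α₁) ∧
        bondNorm L (ι a).k (ι a).η (-(3 : ℝ)) (ι a).Ω (fun x μ => covLap (ι a).η U₀ (fun z => A' z μ) x)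
          ≤ max 1 (2 * B₀ * max 1 (qQ d L Cτ (betaTau τ) s)) * (bondNorm L (ι a).k (ι a).η (-(3 : ℝ)) (ι a).Ω (fun x μ => Jcur (ι a).η U₀ A' μ x)
            + wsup 1 (fun p : {p : ℕ × (Site d × Fin d) // p.1 ≤ (ι a).k ∧ p.2 ∈ ΛbP a (ι a).k p.1} =>
                linCovIter L U₀ (iEta (ι a).η A') p.1.1 p.1.2.1 p.1.2.2))
            + (2 * cS * γ / max 1 (2 * B₀ * max 1 (qQ d L Cτ (betaTau τ) s))) * max 1 (2 * B₀ * max 1 (qQ d L Cτ (betaTau τ) s)) * (α₀ + α₁) ∧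
        msup L (ι a).k (ι a).η (-(2 + β)) (fun j (q : Fin d × Fin d × (Site d × Site d)) => q.2.2 ∈ AdmPair (ι a).η len ∧ q.2.2.1 ∈ (ι a).Ω j ∧ q.2.2.2 ∈ (ι a).Ω j)
            (fun q => hquot (ι a).η β len U₀ (covDerivFwd (ι a).η U₀ q.1 (fun z => A' z q.2.1)) q.2.2)
          ≤ (2 * max 0 Cβ * max 1 (qQ d L Cτ (betaTau τ) s)) * (bondNorm L (ι a).k (ι a).η (-(3 : ℝ)) (ι a).Ω (fun x μ => Jcur (ι a).η U₀ A' μ x)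
            + wsup 1 (fun p : {p : ℕ × (Site d × Fin d) // p.1 ≤ (ι a).k ∧ p.2 ∈ ΛbP a (ι a).k p.1} =>
                linCovIter L U₀ (iEta (ι a).η A') p.1.1 p.1.2.1 p.1.2.2)) + ((max 0 Cβ * cS / B₀ + cSβ) * γ) * (α₀ + α₁) := by
  have hL1 : 1 ≤ L := le_trans (by norm_num) hL
  have hq : 0 ≤ qQ d L Cτ (betaTau τ) s := by
    have hCτ0 : 0 ≤ Cτ := by
      have h := hCτ 1 1
      rw [star_one, one_mul, norm_one, mul_one, mul_one] at h
      exact le_trans (abs_nonneg _) h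
    have hβ : 0 ≤ betaTau τ := by
      unfold betaTau
      split_ifs
      · exact Finset.sum_nonneg fun i _ => mul_nonneg (norm_nonneg _) (norm_nonneg _)
      · exact le_rfl
    have hα : 0 ≤ B9Eq316AveragingTransposeZd.alphaQ d L := (B9Eq316AveragingTransposeZd.alphaQ_pos d hL1).le
    have hθ : 0 ≤ B7Prop5GeneralLevels.thetaGen d L (B9Eq316AveragingTransposeZd.alphaQ d L) := by
      unfold B7Prop5GeneralLevels.thetaGen; positivity
    unfold qQ; positivity
  haveI : NeZero L := ⟨by omega⟩
  have hbox : ∀ a, ∀ j, 1 ≤ j → j ≤ (ι a).k → ∀ c ∈ ΛbP a (ι a).k j, ∀ x, InBox (loK L j c.1) (bondHiK L j c.1 c.2) x → x ∈ (ι a).Ω (j - 1) :=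
    fun a j hj1 hj c hc x hx => (hlaw a j hj c hc x hx).1 hj1
  refine sockB9P3srcH2Per_of_binders L hd2 hL1 hM1 ι p hp hΩJ (fun a => opsAllZdPer τ L (p a) (ΛbP a) ops₀) ΛbP hinv
    (fun a => curvAtInAk_opsAllZdPer L τ (p a) hL1 (ΛbP a) ops₀ hM1 (ι a) (ι a).k)
    (fun a => avgAtP_opsAllZdPer₀ L τ (p a) hd2 hL hCτ (ΛbP a) ops₀ M (ι a) (ι a).k (hlaw a)) hglob hhol
    (fun a => ?_) (fun a => ?_) (fun a => ?_) hsrc hsrcH (by positivity) hq hB₀ hcS hcSβ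
  · haveI := hp a
    exact perAtU_opsAllZdPer L τ (p a) hL hτp hτt hτs (ΛbP a) ops₀ M (ι a) (hdvd a) (hΛ a) (hbox a)
  · haveI := hp a
    exact perDRDsAt_opsAllZdPer L τ (p a) hτs hτp (ΛbP a) ops₀ M (ι a) (ι a).k
  · exact gopAddAt_opsAllZdPer τ L (p a) (ΛbP a) ops₀ M (ι a) (ι a).k

end Genuine

/-! ## §5  The T6e-literal edition: print's class `towerBondsP L (ι a).Ω ((ι a).Λs (ι a).k)` as `|B₁|` -/

section PrintClass

variable (L : ℕ) (τ : 𝔸 →ₗ[ℂ] ℂ) [Nontrivial 𝔸] [FiniteDimensional ℝ 𝔸]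

/-- ★★★ **`SB9srcH2Per` FOR THE GENUINE TORUS RECORD WITH PRINT'S CLASS (1.31) — dag-n05-c T6e's hypothesis LITERALLY** (`|B₁|` over
`towerBondsP L (ι a).Ω ((ι a).Λs (ι a).k) p.1`): §4 at the class map `ΛbP a := fun k j => towerBondsP L (ι a).Ω ((ι a).Λs k) j`, i.e. the record
`opsAllZdPer τ L (p a) (fun k j => towerBondsP L (ι a).Ω ((ι a).Λs k) j) ops₀` (Q′ᵀQ′ of (1.31)'s constraint bonds).  Displayed: the five analytic binders per `a`.
[cite: Balaban1985RegularSpaces, Thm 8 + (1.146) p.101, (1.58)–(1.59) p.86, Prop. 3 p.87, (1.31) p.82, p.77 («Ω_j = T_η»); Balaban1985BackgroundPropagators, Thm 3.3 p.399, (3.42) p.397, (3.43)–(3.47) p.398, Thm 3.11 p.416; Balaban1984PropagatorsII, (2.3) p.224] -/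
theorem sockB9P3srcH2Per_opsAllZdPer_towerBondsP (hd2 : 2 ≤ d) (hL : 2 ≤ L) (hτp : ∀ a : 𝔸, a ≠ 0 → 0 < (τ (star a * a)).re)
    (hτt : ∀ a b : 𝔸, τ (a * b) = τ (b * a)) (hτs : ∀ a : 𝔸, τ (star a) = starRingEnd ℂ (τ a))
    {Cτ : ℝ} (hCτ : ∀ x y : 𝔸, |(τ (star x * y)).re| ≤ Cτ * ‖x‖ * ‖y‖)
    (ops₀ : ℝ → ZdIdx d L → ℕ → OpsZd d 𝔸) {M : ℝ} (hM1 : 1 ≤ M)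
    {J : Type*} (ι : J → ZdIdx d L) (p : J → ℕ) (hp : ∀ a, NeZero (p a)) (hΩJ : ∀ a, (ι a).Ω 0 = Set.univ) {s : ℕ}
    (hdvd : ∀ a, L ^ (ι a).k ∣ p a)
    (hΛ : ∀ a, ∀ j, j ≤ (ι a).k → ∀ κ : Fin d, IsPeriodic (p a / L ^ j) (fun z => (z, κ) ∈ towerBondsP L (ι a).Ω ((ι a).Λs (ι a).k) j))
    (hlaw : ∀ a, LevelSepPP0 L (ι a).k (ι a).Ω (fun k j => towerBondsP L (ι a).Ω ((ι a).Λs k) j) s)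
    {aI aT aS B₀ Cβ β cS cSβ γ : ℝ} {len : Site d → ℝ}
    (hinv : ∀ a, InvAtHIPer (p a) L (opsAllZdPer τ L (p a) (fun k j => towerBondsP L (ι a).Ω ((ι a).Λs k) j) ops₀) aI M (ι a) (ι a).k)
    (hglob : ∀ a, GlobAtIPer (p a) L (opsAllZdPer τ L (p a) (fun k j => towerBondsP L (ι a).Ω ((ι a).Λs k) j) ops₀) aT B₀ M (ι a) (ι a).k)
    (hhol : ∀ a, HolderAtIH2Per (p a) L (opsAllZdPer τ L (p a) (fun k j => towerBondsP L (ι a).Ω ((ι a).Λs k) j) ops₀) aT Cβ β len M (ι a) (ι a).k)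
    (hsrc : ∀ a, SrcAtIPer (p a) L (opsAllZdPer τ L (p a) (fun k j => towerBondsP L (ι a).Ω ((ι a).Λs k) j) ops₀) aS cS M (ι a) (ι a).k)
    (hsrcH : ∀ a, SrcHolderAtIH2Per (p a) L (opsAllZdPer τ L (p a) (fun k j => towerBondsP L (ι a).Ω ((ι a).Λs k) j) ops₀) aS cSβ β len M (ι a) (ι a).k)
    (hB₀ : 0 < B₀) (hcS : 0 ≤ cS) (hcSβ : 0 ≤ cSβ) :
    ∀ a : J, ∀ α₀ α₁ α₂ : ℝ, 0 < α₀ →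
      α₀ ≤ min (1 / 16) (min aI (min aT (min aS (1 / (2 * B₀ * (14 * ((d - 1 : ℕ) : ℝ)) * M + 1))))) → 0 < α₁ → 0 < α₂ →
      α₂ ≤ min (1 / 16) (min aI (min aT (min aS (1 / (2 * B₀ * (14 * ((d - 1 : ℕ) : ℝ)) * M + 1))))) →
      ∀ (U₀ W : Site d → Fin d → 𝔸ˣ), (∀ x κ, U₀ x κ ∈ unitaryUnits 𝔸) → (∀ x κ, W x κ ∈ unitaryUnits 𝔸) →
      IsPeriodic (p a) U₀ → IsPeriodic (p a) W →
      ∀ f : Site d → 𝔸, IsPeriodic (p a) f → InR138 L (ι a).k (ι a).η ((ι a).Ω 0) ((ι a).Λs (ι a).k) U₀ f →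
      (∀ x, IsSelfAdjoint (f x)) → (∀ x, x ∉ (ι a).Ω 0 → f x = 0) →
      Bdd L (ι a).k (ι a).η (-(2 : ℝ)) (fun j (x : Site d) => x ∈ (ι a).Ω j) f →
      msup L (ι a).k (ι a).η (-(2 : ℝ)) (fun j (x : Site d) => x ∈ (ι a).Ω j) f < γ * (α₀ + α₁) →
      msup L (ι a).k (ι a).η (-(3 : ℝ)) (fun j (p : Fin d × Site d) => p.2 ∈ (ι a).Ω j) (fun p => covDerivFwd (ι a).η U₀ p.1 f p.2) < γ * (α₀ + α₁) →
      InAk L (ι a).k (ι a).η α₀ (ι a).Ω U₀ → InAk L (ι a).k (ι a).η α₀ (ι a).Ω (mulCfg W U₀) → IsLandau146W L (ι a).k (ι a).η ((ι a).Ω 0) ((ι a).Λs (ι a).k) U₀ f W →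
      ∀ A' : Site d → Fin d → 𝔸, (∀ y τ, IsSelfAdjoint (A' y τ)) → IsPeriodic (p a) A' →
      (∀ j, j ≤ (ι a).k → ∀ (y : Site d) (τ : Fin d), SideTouches ((ι a).Ω j) y τ →
        W y τ = cfgExp (ι a).η A' y τ ∧ ‖A' y τ‖ ≤ α₂ * ((L : ℝ) ^ j * (ι a).η)⁻¹) →
      (∀ (y : Site d) (τ : Fin d), (∀ j, j ≤ (ι a).k → ¬ SideTouches ((ι a).Ω j) y τ) → A' y τ = 0) →
      msup L (ι a).k (ι a).η (-(1 : ℝ)) (fun j (b : Site d × Fin d) => SideTouches ((ι a).Ω j) b.1 b.2) (fun b => A' b.1 b.2)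
          ≤ max 1 (2 * B₀ * max 1 (qQ d L Cτ (betaTau τ) s)) * (bondNorm L (ι a).k (ι a).η (-(3 : ℝ)) (ι a).Ω (fun x μ => Jcur (ι a).η U₀ A' μ x)
            + wsup 1 (fun p : {p : ℕ × (Site d × Fin d) // p.1 ≤ (ι a).k ∧ p.2 ∈ towerBondsP L (ι a).Ω ((ι a).Λs (ι a).k) p.1} =>
                linCovIter L U₀ (iEta (ι a).η A') p.1.1 p.1.2.1 p.1.2.2))
            + (2 * cS * γ / max 1 (2 * B₀ * max 1 (qQ d L Cτ (betaTau τ) s))) * max 1 (2 * B₀ * max 1 (qQ d L Cτ (betaTau τ) s)) * (α₀ + α₁) ∧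
        msup L (ι a).k (ι a).η (-(2 : ℝ)) (fun j (t : Fin d × Fin d × Site d) => SideTouches ((ι a).Ω j) t.2.2 t.2.1)
            (fun t => covDerivFwd (ι a).η U₀ t.1 (fun z => A' z t.2.1) t.2.2)
          ≤ max 1 (2 * B₀ * max 1 (qQ d L Cτ (betaTau τ) s)) * (bondNorm L (ι a).k (ι a).η (-(3 : ℝ)) (ι a).Ω (fun x μ => Jcur (ι a).η U₀ A' μ x)
            + wsup 1 (fun p : {p : ℕ × (Site d × Fin d) // p.1 ≤ (ι a).k ∧ p.2 ∈ towerBondsP L (ι a).Ω ((ι a).Λs (ι a).k) p.1} =>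
                linCovIter L U₀ (iEta (ι a).η A') p.1.1 p.1.2.1 p.1.2.2))
            + (2 * cS * γ / max 1 (2 * B₀ * max 1 (qQ d L Cτ (betaTau τ) s))) * max 1 (2 * B₀ * max 1 (qQ d L Cτ (betaTau τ) s)) * (α₀ + α₁) ∧
        bondNorm L (ι a).k (ι a).η (-(3 : ℝ)) (ι a).Ω (fun x μ => pdiv (ι a).η U₀ (plaqCovDeriv (ι a).η U₀ A') μ x)
          ≤ max 1 (2 * B₀ * max 1 (qQ d L Cτ (betaTau τ) s)) * (bondNorm L (ι a).k (ι a).η (-(3 : ℝ)) (ι a).Ω (fun x μ => Jcur (ι a).η U₀ A' μ x)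
            + wsup 1 (fun p : {p : ℕ × (Site d × Fin d) // p.1 ≤ (ι a).k ∧ p.2 ∈ towerBondsP L (ι a).Ω ((ι a).Λs (ι a).k) p.1} =>
                linCovIter L U₀ (iEta (ι a).η A') p.1.1 p.1.2.1 p.1.2.2))
            + (2 * cS * γ / max 1 (2 * B₀ * max 1 (qQ d L Cτ (betaTau τ) s))) * max 1 (2 * B₀ * max 1 (qQ d L Cτ (betaTau τ) s)) * (α₀ + α₁) ∧
        bondNorm L (ι a).k (ι a).η (-(3 : ℝ)) (ι a).Ω (fun x μ => covLap (ι a).η U₀ (fun z => A' z μ) x)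
          ≤ max 1 (2 * B₀ * max 1 (qQ d L Cτ (betaTau τ) s)) * (bondNorm L (ι a).k (ι a).η (-(3 : ℝ)) (ι a).Ω (fun x μ => Jcur (ι a).η U₀ A' μ x)
            + wsup 1 (fun p : {p : ℕ × (Site d × Fin d) // p.1 ≤ (ι a).k ∧ p.2 ∈ towerBondsP L (ι a).Ω ((ι a).Λs (ι a).k) p.1} =>
                linCovIter L U₀ (iEta (ι a).η A') p.1.1 p.1.2.1 p.1.2.2))
            + (2 * cS * γ / max 1 (2 * B₀ * max 1 (qQ d L Cτ (betaTau τ) s))) * max 1 (2 * B₀ * max 1 (qQ d L Cτ (betaTau τ) s)) * (α₀ + α₁) ∧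
        msup L (ι a).k (ι a).η (-(2 + β)) (fun j (q : Fin d × Fin d × (Site d × Site d)) => q.2.2 ∈ AdmPair (ι a).η len ∧ q.2.2.1 ∈ (ι a).Ω j ∧ q.2.2.2 ∈ (ι a).Ω j)
            (fun q => hquot (ι a).η β len U₀ (covDerivFwd (ι a).η U₀ q.1 (fun z => A' z q.2.1)) q.2.2)
          ≤ (2 * max 0 Cβ * max 1 (qQ d L Cτ (betaTau τ) s)) * (bondNorm L (ι a).k (ι a).η (-(3 : ℝ)) (ι a).Ω (fun x μ => Jcur (ι a).η U₀ A' μ x)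
            + wsup 1 (fun p : {p : ℕ × (Site d × Fin d) // p.1 ≤ (ι a).k ∧ p.2 ∈ towerBondsP L (ι a).Ω ((ι a).Λs (ι a).k) p.1} =>
                linCovIter L U₀ (iEta (ι a).η A') p.1.1 p.1.2.1 p.1.2.2)) + ((max 0 Cβ * cS / B₀ + cSβ) * γ) * (α₀ + α₁) :=
  sockB9P3srcH2Per_opsAllZdPer_of_binders L τ hd2 hL hτp hτt hτs hCτ ops₀ hM1 ι p hp hΩJ (fun a k j => towerBondsP L (ι a).Ω ((ι a).Λs k) j)
    hdvd hΛ hlaw hinv hglob hhol hsrc hsrcH hB₀ hcS hcSβ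

end PrintClass

end Literature.MathematicalPhysics.QuantumFieldTheory.Balaban1983to89.B9SupplySockB9P3ZdSrcPer

end
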